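import Literature.MathematicalPhysics.QuantumFieldTheory.Balaban1983to89.B3Op116MajorantStepBox
import Literature.MathematicalPhysics.QuantumFieldTheory.Balaban1983to89.B3Op116CollarRowReduce

/-!
# `Balaban1983to89.B3Op116DKernelRegularBox` — T. Bałaban, *(Higgs)₂,₃ quantum fields in a finite volume. III. Renormalization*,
# Commun. Math. Phys. **88** (1983) 411–445 [Balaban1983Higgs3], (1.16) p. 414 / (2.5)–(2.6) p. 424 / (2.10) p. 426 / p. 433:
# **THE KERNEL OF THE OPERATOR (1.16) ON A `k`-BLOCK UNION `□` — SOURCE ANYWHERE IN `□`, NO SUPPORT CLAUSE ON THE PERTURBATION —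
# IS UNIFORMLY BOUNDED AND EXPONENTIALLY DECAYING AT EVERY POINT (`n + n′ + 2 > d`), AND SO IS ITS ROW DERIVATIVE AT THE BONDS OF `□`
# UP TO ONE DISPLAYED FACE SHEET (`n + n′ + 1 > d`)**: one `V_k`-insertion step on a `k`-block union in the three-component («pending sheet»)
# majorant state, the induction over the `n + n′` insertions of (1.16), and the end-point theorems — the box twin of
# `B3Op116DKernelRegularTorus.{step_fields, seqC, step_state, state_op116, base_state, kernel116_value_le, kernel116_deriv_le}`; F4 of p35
# `DESIGN-FILE4.md` §14–§17 (route γ′ of GAPS.md G-B3-16.A1)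

statement-level skeleton of published theorems with citation tags; proofs where landed; nothing here is a claim about the Yang–Mills mass gap

PDF held: `paper:balaban1983-higgs-2-3-quantum-fields-finite-volume` (journal page = PDF page + 410; p. 414 = `p0004.txt`, p. 424 = `p0014.txt`,
p. 426 = `p0016.txt`, p. 433 = `p0023.txt`).

CITATION HEADER (lean-in-tree rule).  T. Bałaban, CMP **88** (1983) 411–445 [Balaban1983Higgs3]: (1.16) p. 414, (2.5)/(2.6) p. 424, (2.10)
p. 426, p. 433; part I, CMP **85** (1982) 603–636 [Balaban1982Higgs1]: (3.16) p. 615, (2.20) p. 610.  Cell `lit-balaban` (HOME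
`run/shared/lean/pub/lit-balaban/`), Phase-2 proof seat **p35** gen 27 (literature-prover-lit-balaban-p35-g27-0; free-target protocol G.5-34(d),
TAKING HOME/STATUS.md 2026-08-23T16:58:04Z, cc p40 / r15 / r14 / p33).  SKELETON rows **B3.Eq1.16** / **B3.Eq2.5** / **B3.Txt@433** /
**B3.Prop1** (owner r15) — LOCATED ENGINE + MEMBERS of the «(2.5) for (1.16) on a cell-product box `□` without the support clause» programme (GAPS.md
G-B3-16.A1, route γ′), no head claim.  USED BY NAME, never restated: p35 g27's `B3Op116CollarRowReduce.{kapF, collar_row_reduce, propagatorK_srcV_apply_eq_zero_of_not_mem,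
proj_propagatorK_single_eq_zero, covDerivAt_propagatorK_single_eq_zero, col_le_maj_all, dcol_le_maj_all}` (the located Leibniz row of p40's
`B3Op116CollarSources.norm_mapE_srcV_collar_leibniz_le` reduced to F3's three-slot row), p35 g26's `B3Op116MajorantStepBox.{stepBoxC, stepBoxVC, faceK,
row_step_box_le, row_step_box_deriv_le, pair_face_le}` (F3), `B3Op116MajorantStep.{maj, stepC, row_step_le}`, `B3Op116MajorantStep.maj`, `B3Op116DKernelRegularTorus.{kap4, mesh_rpow_split_two, mesh_rpow_split_one, rate_div_eq}`, p33's
`B3Op116MajorantConvolution.majorant_le_top`, r14's `B3Op116SourceForm.{srcV, op116_zero_zero_apply, op116_succ_left_apply, op116_succ_right_apply}`,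
p40's `B3Eq116TwoSidedExpansion.op116` and `B3Op116CollarSources.propagatorK_cb_apply_eq_zero_of_mem`.

WHAT IS PRINTED (verbatim).  p. 414 [PDF 4]: *"in the last term of this expansion, equal to [G_k(Ω,B̃)V_k(Ã,B̃)]^n G_k(Ω,Ã+B̃)[V_k(Ã,B̃)G_k(Ω,B̃)]^{n′},
(1.16) we have the propagator G_k(Ω,Ã+B̃). … for n, n′ sufficiently large, a kernel of the operator (1.16) is a sufficiently regular function of
both variables … uniformly bounded by O(1)(e(L^kε)^{1−α})^{n+n′}"*; p. 433 [PDF 23]: *"We assume that □₁, □ are sums of big blocks of the unit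
lattice. … We have B̃ = B̃₀ + B̃′, and we expand in B̃′ … we include the operators (1.16) … into the external fields."*

WHAT THIS FILE PROVES (`Ω` a union of `k`-blocks; `m² > 0`, `a_k ≥ 0`, `1 ≤ k ≤ K`, `L > 1`; `sup|A| ≤ s`, `A` regular with `δ_A` on `T_ε`; the (2.10)
dictionary of `G_k(Ω,B)` AND `G_k(Ω,A+B)` on `Ω` — `κ ≤ 𝔪_k(c_{K2},2;δ₁)`, `κ^D_B ≤ 𝔪_k(c_{K1},1;δ₁)(b₋,·)` at the bonds `⊂ Ω`, `0 < δ₁ ≤ 1` — as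
HYPOTHESES; a face family `F_i ⊆ {u_{ν_i} = c_i}` covering the legs of the bonds of `supp A` crossing `∂Ω`).
* §0 ONE STEP (`step_fields_box`, incoming sheet, `a_v > 2`; `step_fields_box_zero`, no sheet, `a_v > 1`): if `w` vanishes off `Ω`,
  `‖w(y)‖ ≤ 𝔪_k(cv,a_v;δ)(y,x′)`, `‖D^ε_Bw(b)‖ ≤ 𝔪_k(cd,a_v−1;δ)(b₋,x′) + Σ_iΣ_{u∈F_i}𝔪_k(c_{K1},1;δ)(b₋,u)S(u)` at the bonds `b ⊂ Ω` with a sheet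
  `0 ≤ S ≤ 𝔪_k(cS,a_v−1;δ)(·,x′)`, then `w′ = G_k(Ω,X)V_k^Ω(A,B)w` (`X ∈ {B, A+B}`) vanishes off `Ω`, `‖w′(y)‖ ≤ 𝔪_k(stepBoxVC, a_v+1; δ/4L)(y,x′)` at ALL
  `y`, `‖D^ε_Bw′(b)‖ ≤ 𝔪_k(stepBoxC(1,…), a_v; δ/4L)(b₋,x′) + Σ_iΣ_{u∈F_i}𝔪_k(c_{K1},1;δ/4L)(b₋,u)·κ_F‖w(u)‖` at the bonds `⊂ Ω`, with the NEW sheet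
  `κ_F‖w‖ ≤ 𝔪_k(κ_F·cv, a_v; δ/4L)` — the located Leibniz row (`collar_row_reduce`) fed to F3's abstract rows; `stepBoxC_zero_sheet`: at `cS = 0` the
  constants are the torus `stepC` (ring identity).
* §1 THE EXPLICIT RECURSION `seqB` of `(δ_J, cv_J, cd_J, cS_J)`: seed `(δ₀, cv₀, cd₀, 0)`, then `(δ_J/(4L), stepBoxVC(2,2+J,…,κ_F), stepBoxC(1,2+J,…),
  κ_F·cv_J)`; positivity (`seqB_pos`), closed rate `δ_J = δ₀/(4L)^J` (`rateB_closed`).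
* §2 THE STATE `BoxState` (a PREDICATE on fields, NOT a statement: support in `Ω`; values `≤ 𝔪_k(cv,a_v;δ)(·,x′)`; derivatives at the bonds `⊂ Ω`
  `≤ 𝔪_k(cd,a_v−1;δ)(b₋,x′) + Σ_iΣ_{u∈F_i}𝔪_k(c_{K1},1;δ)(b₋,u)S(u)` for SOME sheet `0 ≤ S ≤ 𝔪_k(cS,a_v−1;δ)(·,x′)`), a sheet-free entry
  (`boxState_zero_of_sheet_free`) and **`step_state_box`**: the state `J` goes to the state `J + 1` under `w ↦ G_k(Ω,X)V_k^Ω(A,B)w`, `X ∈ {B, A+B}`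
  (`J = 0`: `cS₀ = 0` forces `S = 0`, `step_fields_box_zero`; `J ≥ 1`: `step_fields_box`).
* §3 **`state_op116_box`**: THE INDUCTION over `(n, n′)`: both images `G_k(Ω,X)ψ` in the state `J` ⟹ `(1.16)^Ω_{n,n′}ψ` in the state `J + n + n′` —
  any seed triple `(δ₀, cv₀, cd₀)`.
* §4 THE UNIT SOURCES `e_{(x′,i′)}`, `x′ ∈ Ω`, are in the state `0` of the seed `(δ₁, c_{K2}, c_{K1}, 0)` (`base_state_box`); hence `state_op116_box_cb`.
* §5 **`kernel116_value_box_le`**: for `d < n + n′ + 2`, EVERY `x` and every `x′ ∈ Ω`,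
  `ε^{−d}Σ_{i′}‖((1.16)^Ω_{n,n′}e_{(x′,i′)})(x)‖ ≤ valCB(n+n′)·(L^kε)^{n+n′}·(L^kε)²((L^kε)^d)^{−1}·e^{−δ_{n+n′}|x−x′|/L^k}`, `δ_M = δ₁/(4L)^M` — p40's
  binder shape `hV` (`B3Ineq25Op116SmoothInner`) at ALL points, no support clause on `A`, no margin; **`kernel116_deriv_box_le`**: for `d < n + n′ + 1`,
  every bond `⟨x,x+εe_μ⟩ ⊂ Ω`: the same with `derCB`, one exponent lower, PLUS the displayed end sheet
  `ε^{−d}·N·Σ_iΣ_{u∈F_i}𝔪_k(c_{K1},1;δ_M)(x,u)·𝔪_k(cS_M,1+M;δ_M)(u,x′)` (one layer on `∂Ω` read through the last differentiated column; its margin form,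
  uniform in `k` one top block inside the faces, is the sequel `B3Op116DKernelRegularCellBox`).
HONEST SCOPE.  (B)-level: dictionary, regularity and the face family are hypotheses (the plug on cell-product boxes is the sequel); thresholds = the
torus file's honest order count (`G` ↦ −2, `V` ↦ +1, `D` ↦ +1).  NOT here: the margin form of the end sheet, the Hölder member (`B3Op116HolderKernelRegularBox`),
the mixed/dipole seeds, r15's `Ineq25At` assembly.  Route γ′ of G-B3-16.A1 (print's one-piece expansion on `□`; the face bookkeeping is the cell's).
Concrete `def`s (`seqB`, `rateB`, `cvB`, `cdB`, `cSB`, `valCB`, `derCB`; F3's `stepBoxC`/`stepBoxVC` are imported) and one predicate `BoxState` on fields; no `def … : Prop` fact, no new named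
fact, no `sorry`; axioms standard.  Value = located engine/members of a by-reference step of B3 — NOT summit progress and nothing about the mass gap.
-/

noncomputable section

open scoped BigOperators

namespace Literature.MathematicalPhysics.QuantumFieldTheory.Balaban1983to89.B3Op116DKernelRegularBox

open HiggsLattice (ChargeData ScalarField covDeriv)
open HiggsCovariance (propagatorK E)
open HiggsCovariancePos (Inside)
open HiggsAveraging (blockIter)
open B1Eq230FluctCov (Ix cb)
open B3Op116SourceForm (srcV covDerivAt op116_zero_zero_apply op116_succ_left_apply op116_succ_right_apply)
open B3Op116MajorantStep (maj maj_nonneg maj_rate_mono maj_add mul_maj stepC stepC_nonneg row_step_le maj_const_mono)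
open B3Op116MajorantStepBox (faceK faceK_nonneg stepBoxC stepBoxC_nonneg stepBoxVC row_step_box_le row_step_box_deriv_le pair_face_le)
open B3Op116CollarSources (inB exB enB mem_inB propagatorK_cb_apply_eq_zero_of_mem)
open B3Op116DKernelRegularTorus (kap4 kap4_nonneg mesh_rpow_split_two mesh_rpow_split_one rate_div_eq)
open B3Op116CollarRowReduce (kapF kapF_nonneg collar_row_reduce propagatorK_srcV_apply_eq_zero_of_not_mem proj_propagatorK_single_eq_zero
  covDerivAt_propagatorK_single_eq_zero col_le_maj_all dcol_le_maj_all)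
open B3Eq116TwoSidedExpansion (op116)
open B3Op116MajorantConvolution (majorant_le_top)

variable {P : HiggsLattice.Params} {N : ℕ}

/-! ## §0 THE STEP on the three-component state: `w ↦ G_k(Ω,X)V_k^Ω(A,B)w` -/

section Step

/-- with NO incoming sheet (`c_S = 0`) the derivative-column constant of F3 is the torus constant: `stepBoxC(…, c_S = 0, …) = stepC(…)`.
[cite: Balaban1983Higgs3, (1.16) p.414, (2.10) p.426] -/
theorem stepBoxC_zero_sheet (k nF : ℕ) (δ aK av cK cv cd c₁ κ₁ κ₂ κ₃ κ₄ : ℝ) :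
    stepBoxC P N k nF δ aK av cK cv cd 0 c₁ κ₁ κ₂ κ₃ κ₄ = stepC P N k δ aK av cK cv cd κ₁ κ₂ κ₃ κ₄ := by
  unfold stepBoxC; ring

/-- idem for the value column: `stepBoxVC(…, c_S = 0, …, κ_F) = stepC(…) + n_F·κ_F·c_Kc_v·K_F`. [cite: Balaban1983Higgs3, (1.16) p.414, (2.10) p.426] -/
theorem stepBoxVC_zero_sheet (k nF : ℕ) (δ aK av cK cv cd c₁ κ₁ κ₂ κ₃ κ₄ κF : ℝ) :
    stepBoxVC P N k nF δ aK av cK cv cd 0 c₁ κ₁ κ₂ κ₃ κ₄ κF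
      = stepC P N k δ aK av cK cv cd κ₁ κ₂ κ₃ κ₄ + (nF : ℝ) * (κF * (cK * cv * faceK P δ aK av)) := by
  unfold stepBoxVC stepBoxC; ring

/-- `stepBoxVC ≥ 0` (`a_K > 1`, `a_v > 2`, all constants `≥ 0`). [cite: Balaban1983Higgs3, (2.10) p.426] -/
theorem stepBoxVC_nonneg (hL : 1 < P.L) (k nF : ℕ) {δ aK av cK cv cd cS c₁ κ₁ κ₂ κ₃ κ₄ κF : ℝ} (hδ : 0 < δ) (haK : 1 < aK)
    (hav : 2 < av) (hcK : 0 ≤ cK) (hcv : 0 ≤ cv) (hcd : 0 ≤ cd) (hcS : 0 ≤ cS) (hc₁ : 0 ≤ c₁) (hκ₁ : 0 ≤ κ₁) (hκ₂ : 0 ≤ κ₂)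
    (hκ₃ : 0 ≤ κ₃) (hκ₄ : 0 ≤ κ₄) (hκF : 0 ≤ κF) : 0 ≤ stepBoxVC P N k nF δ aK av cK cv cd cS c₁ κ₁ κ₂ κ₃ κ₄ κF := by
  have h1 := stepBoxC_nonneg hL k nF (N := N) (κ₂ := κ₂) (κ₃ := κ₃) (κ₄ := κ₄) hδ (show (0:ℝ) < aK by linarith) hav hcK hcv hcd hcS hc₁
    hκ₁ hκ₂ hκ₃ hκ₄
  have h2 := faceK_nonneg hL hδ haK (by linarith : 1 < av)
  unfold stepBoxVC; positivity

/-- `stepBoxVC(…, c_S = 0, …) ≥ 0` already for `a_v > 1`. [cite: Balaban1983Higgs3, (2.10) p.426] -/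
theorem stepBoxVC_zero_sheet_nonneg (hL : 1 < P.L) (k nF : ℕ) {δ aK av cK cv cd c₁ κ₁ κ₂ κ₃ κ₄ κF : ℝ} (hδ : 0 < δ) (haK : 1 < aK)
    (hav : 1 < av) (hcK : 0 ≤ cK) (hcv : 0 ≤ cv) (hcd : 0 ≤ cd) (hκ₁ : 0 ≤ κ₁) (hκ₂ : 0 ≤ κ₂) (hκ₃ : 0 ≤ κ₃) (hκ₄ : 0 ≤ κ₄)
    (hκF : 0 ≤ κF) : 0 ≤ stepBoxVC P N k nF δ aK av cK cv cd 0 c₁ κ₁ κ₂ κ₃ κ₄ κF := by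
  have h1 := stepC_nonneg hL k (N := N) (κ₁ := κ₁) (κ₂ := κ₂) (κ₃ := κ₃) (κ₄ := κ₄) hδ (show (0:ℝ) < aK by linarith) hav hcK hcv hcd
    hκ₁ hκ₂ hκ₃ hκ₄
  have h2 := faceK_nonneg hL hδ haK hav
  rw [stepBoxVC_zero_sheet]; positivity

variable {C : ChargeData N} {Ω : Finset (HiggsLattice.Site P 0)} {A B X : HiggsLattice.VecField P 0} {msq a : ℝ} {k : ℕ}
  {δ₁ s δA cK2 cK1 : ℝ}

variable (hL : 1 < P.L) (hk : 1 ≤ k) (hkK : k ≤ P.K) (hmsq : 0 < msq) (hak : 0 ≤ B1.aSeq a P.L k)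
  (hΩ : ∀ x x' : HiggsLattice.Site P 0, blockIter k x = blockIter k x' → (x ∈ Ω ↔ x' ∈ Ω))
  (hcK2 : 0 ≤ cK2) (hcK1 : 0 ≤ cK1)
  (hcolX : ∀ x ∈ Ω, ∀ z ∈ Ω, ∑ i : Ix N, ‖propagatorK C Ω X msq a k (cb P N 0 (z, i)) x‖ ≤ maj P k cK2 2 δ₁ x z)
  (hdcolX : ∀ b : HiggsLattice.PBond P 0, Inside Ω b → ∀ z ∈ Ω,
    ∑ i : Ix N, ‖covDeriv C B (propagatorK C Ω X msq a k (cb P N 0 (z, i))) b‖ ≤ maj P k cK1 1 δ₁ b.src z)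
  (hδ₁1 : δ₁ ≤ 1) (hs : 0 ≤ s) (hA : ∀ b : HiggsLattice.PBond P 0, |A b| ≤ s) (hδA : 0 ≤ δA)
  (hregA : ∀ (z : HiggsLattice.Site P 0) (μ ν : Fin P.d), |A ⟨z.shift ν, μ⟩ - A ⟨z, μ⟩| ≤ δA)
  (i₀ : Ix N) (x' : HiggsLattice.Site P 0)
  {nF : ℕ} (F : Fin nF → Finset (HiggsLattice.Site P 0)) (ν : Fin nF → Fin P.d)
  (c : (i : Fin nF) → ZMod (P.sitesPerDir 0 (ν i))) (hF : ∀ i, ∀ u ∈ F i, u (ν i) = c i)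
  (hexF : ∀ b ∈ exB Ω A, ∃ i : Fin nF, b.src ∈ F i) (henF : ∀ b ∈ enB Ω A, ∃ i : Fin nF, b.tgt ∈ F i)
include hL hk hkK hmsq hak hΩ hcK2 hcK1 hcolX hdcolX hδ₁1 hs hA hδA hregA i₀ hF hexF henF

/-- **THE STEP ON A BOX, INCOMING SHEET** (value exponent `a_v > 2`).  `Ω` a union of `k`-blocks, `m² > 0`, `a_k ≥ 0`, `1 ≤ k ≤ K`, `L > 1`;
the (2.10) dictionary of `G_k(Ω,X)` on `Ω` (`κ ≤ 𝔪_k(c_{K2},2;δ₁)`, `κ^D_B ≤ 𝔪_k(c_{K1},1;δ₁)(b₋,·)` at the bonds `⊂ Ω`), `sup|A| ≤ s`, `A` regular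
with `δ_A`; faces `F_i ⊆ {u_{ν_i} = c_i}` covering the legs.  If `w` vanishes off `Ω`, `‖w(y)‖ ≤ 𝔪_k(c_v,a_v;δ)(y,x′)`, and at the bonds `⊂ Ω`
`‖D^ε_Bw(b)‖ ≤ 𝔪_k(c_d,a_v−1;δ)(b₋,x′) + Σ_iΣ_{u∈F_i}𝔪_k(c_{K1},1;δ)(b₋,u)S_i(u)` with `0 ≤ S_i ≤ 𝔪_k(c_S,a_v−1;δ)(·,x′)` (`0 < δ ≤ δ₁ ≤ 1`), then
`w⁺ = G_k(Ω,X)V_k^Ω(A,B)w`: (i) vanishes off `Ω`; (ii) `‖w⁺(y)‖ ≤ 𝔪_k(stepBoxVC(2,a_v,…,κ_F), a_v+1; δ/(4L))(y,x′)` at every `y`;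
(iii) `‖D^ε_Bw⁺(b₀)‖ ≤ 𝔪_k(stepBoxC(1,a_v,…), a_v; δ/(4L))(b₀₋,x′) + Σ_iΣ_{u∈F_i}𝔪_k(c_{K1},1;δ/(4L))(b₀₋,u)·κ_F‖w(u)‖` at every `b₀ ⊂ Ω`;
(iv) the new sheet `κ_F‖w‖` is `≥ 0` and `≤ 𝔪_k(κ_Fc_v, a_v; δ/(4L))(·,x′)` — `collar_row_reduce` + F3's `row_step_box_le` / `row_step_box_deriv_le`.
[cite: Balaban1983Higgs3, (1.16) p.414, (2.5)–(2.6) p.424, (2.10) p.426, p.433] [cite: Balaban1982Higgs1, (3.16) p.615, (2.20) p.610] -/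
theorem step_fields_box {δ cv cd cS av : ℝ} (hδ : 0 < δ) (hδδ₁ : δ ≤ δ₁) (hav : 2 < av) (hcv : 0 ≤ cv) (hcd : 0 ≤ cd) (hcS : 0 ≤ cS)
    (w : ScalarField P 0 N) (hw : ∀ y : HiggsLattice.Site P 0, y ∉ Ω → w y = 0) (hV : ∀ y, ‖w y‖ ≤ maj P k cv av δ y x')
    (S : Fin nF → HiggsLattice.Site P 0 → ℝ) (hS0 : ∀ i u, 0 ≤ S i u) (hS : ∀ i u, S i u ≤ maj P k cS (av - 1) δ u x')
    (hD : ∀ b : HiggsLattice.PBond P 0, Inside Ω b →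
      ‖covDeriv C B w b‖ ≤ maj P k cd (av - 1) δ b.src x' + ∑ i : Fin nF, ∑ u ∈ F i, maj P k cK1 1 δ b.src u * S i u) :
    (∀ y : HiggsLattice.Site P 0, y ∉ Ω → propagatorK C Ω X msq a k (srcV C A B k Ω a w) y = 0) ∧
    (∀ y, ‖propagatorK C Ω X msq a k (srcV C A B k Ω a w) y‖
        ≤ maj P k (stepBoxVC P N k nF δ 2 av cK2 cv cd cS cK1 (|C.e| * s) ((P.mesh 0)⁻¹ * (|C.e| * δA)) ((|C.e| * s) ^ 2)
            (kap4 P C k a s) (kapF P C s δA)) (2 + av - 1) (δ / 2 / P.L / 2) y x') ∧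
    (∀ b₀ : HiggsLattice.PBond P 0, Inside Ω b₀ →
      ‖covDeriv C B (propagatorK C Ω X msq a k (srcV C A B k Ω a w)) b₀‖
        ≤ maj P k (stepBoxC P N k nF δ 1 av cK1 cv cd cS cK1 (|C.e| * s) ((P.mesh 0)⁻¹ * (|C.e| * δA)) ((|C.e| * s) ^ 2)
              (kap4 P C k a s)) (1 + av - 1) (δ / 2 / P.L / 2) b₀.src x'
          + ∑ i : Fin nF, ∑ u ∈ F i, maj P k cK1 1 (δ / 2 / P.L / 2) b₀.src u * (kapF P C s δA * ‖w u‖)) ∧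
    (∀ u : HiggsLattice.Site P 0, 0 ≤ kapF P C s δA * ‖w u‖ ∧
      kapF P C s δA * ‖w u‖ ≤ maj P k (kapF P C s δA * cv) av (δ / 2 / P.L / 2) u x') := by
  have hL1 : (1 : ℝ) < (P.L : ℝ) := by exact_mod_cast hL
  have hδ1 : δ ≤ 1 := hδδ₁.trans hδ₁1
  have hes : 0 ≤ |C.e| * s := mul_nonneg (abs_nonneg _) hs
  have hκ₂ : 0 ≤ (P.mesh 0)⁻¹ * (|C.e| * δA) := mul_nonneg (inv_nonneg.mpr (P.mesh_pos 0).le) (mul_nonneg (abs_nonneg _) hδA)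
  have hκ₄ : 0 ≤ kap4 P C k a s := kap4_nonneg hs
  have hκF : 0 ≤ kapF P C s δA := kapF_nonneg hs hδA
  have hrate : δ / 2 / P.L / 2 ≤ δ := by
    rw [div_div, div_div, div_le_iff₀ (by positivity)]; nlinarith
  have hav1 : 1 < av := by linarith
  set G : ScalarField P 0 N →ₗ[ℝ] ScalarField P 0 N := propagatorK C Ω X msq a k with hG
  -- the derivative majorant of the state as the `Df` of the reduction
  set Df : HiggsLattice.PBond P 0 → ℝ := fun b =>
    maj P k cd (av - 1) δ b.src x' + ∑ i : Fin nF, ∑ u ∈ F i, maj P k cK1 1 δ b.src u * S i u with hDf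
  have hDf0 : ∀ b, 0 ≤ Df b := fun b => add_nonneg (maj_nonneg hcd _ _)
    (Finset.sum_nonneg fun i _ => Finset.sum_nonneg fun u _ => mul_nonneg (maj_nonneg hcK1 _ _) (hS0 i u))
  have hDfin : ∀ b ∈ inB Ω A, ‖covDeriv C B w b‖ ≤ Df b := fun b hb => hD b (mem_inB.1 hb).1
  have hsupp := propagatorK_srcV_apply_eq_zero_of_not_mem C Ω A B a hΩ X hmsq hak w hw
  refine ⟨hsupp, fun y => ?_, fun b₀ hb₀ => ?_, fun u => ?_⟩
  · -- (ii) the value row at `y`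
    by_cases hy : y ∈ Ω
    · set T : ScalarField P 0 N →ₗ[ℝ] E N := (LinearMap.proj y : ScalarField P 0 N →ₗ[ℝ] E N) ∘ₗ G with hT
      have hT' : ∀ φ : ScalarField P 0 N, T φ = (G φ) y := fun φ => rfl
      have hTk : ∀ z : HiggsLattice.Site P 0, z ∉ Ω → ∀ v : E N, T (Pi.single z v) = 0 := fun z hz v =>
        proj_propagatorK_single_eq_zero C Ω X a hmsq hak hΩ hy hz v
      have hred := collar_row_reduce C Ω A B a hkK T hs hδA hA hregA hTk w hw Df hDf0 hDfin F hexF henF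
      have hK0 : ∀ z, 0 ≤ ∑ i : Ix N, ‖T (cb P N 0 (z, i))‖ := fun z => Finset.sum_nonneg fun _ _ => norm_nonneg _
      have hK : ∀ z, ∑ i : Ix N, ‖T (cb P N 0 (z, i))‖ ≤ maj P k cK2 2 δ y z := fun z => by
        simp only [hT', hG]
        exact (col_le_maj_all C Ω X a hmsq hak hΩ hcK2 hcolX hy z).trans (maj_rate_mono hcK2 hδδ₁ y z)
      have hstep := row_step_box_le (N := N) hL hk hkK hδ hδ1 (by norm_num : (1:ℝ) < 2) hav hcK2 hcv hcd hcS hcK1 hes hκ₂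
        (sq_nonneg (|C.e| * s)) hκ₄ hκF i₀ y x' F ν c hF (fun z => ∑ i : Ix N, ‖T (cb P N 0 (z, i))‖) hK0 hK
        (fun z => ‖w z‖) (fun z => norm_nonneg _) hV S (fun i u _ => hS0 i u) (fun i u _ => hS i u) Df (fun b => le_rfl)
      rw [← hT']
      exact hred.trans hstep
    · rw [hsupp y hy, norm_zero]
      exact maj_nonneg (stepBoxVC_nonneg hL k nF hδ (by norm_num) hav hcK2 hcv hcd hcS hcK1 hes hκ₂ (sq_nonneg _) hκ₄ hκF) _ _
  · -- (iii) the derivative row at `b₀ ⊂ Ω`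
    set T : ScalarField P 0 N →ₗ[ℝ] E N := covDerivAt C B b₀ ∘ₗ G with hT
    have hT' : ∀ φ : ScalarField P 0 N, T φ = covDeriv C B (G φ) b₀ := fun φ => rfl
    have hTk : ∀ z : HiggsLattice.Site P 0, z ∉ Ω → ∀ v : E N, T (Pi.single z v) = 0 := fun z hz v =>
      covDerivAt_propagatorK_single_eq_zero C Ω X a hmsq hak hΩ B hb₀ hz v
    have hred := collar_row_reduce C Ω A B a hkK T hs hδA hA hregA hTk w hw Df hDf0 hDfin F hexF henF
    have hK0 : ∀ z, 0 ≤ ∑ i : Ix N, ‖T (cb P N 0 (z, i))‖ := fun z => Finset.sum_nonneg fun _ _ => norm_nonneg _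
    have hK1 : ∀ z, ∑ i : Ix N, ‖T (cb P N 0 (z, i))‖ ≤ maj P k cK1 1 δ₁ b₀.src z := fun z => by
      simp only [hT', hG]
      exact dcol_le_maj_all C Ω X a hmsq hak hΩ B hcK1 hdcolX hb₀ z
    have hK : ∀ z, ∑ i : Ix N, ‖T (cb P N 0 (z, i))‖ ≤ maj P k cK1 1 δ b₀.src z := fun z =>
      (hK1 z).trans (maj_rate_mono hcK1 hδδ₁ _ z)
    have hstep := row_step_box_deriv_le (N := N) hL hk hkK hδ hδ1 (by norm_num : (0:ℝ) < 1) hav hcK1 hcv hcd hcS hcK1 hes hκ₂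
      (sq_nonneg (|C.e| * s)) hκ₄ i₀ b₀.src x' F ν c hF (fun z => ∑ i : Ix N, ‖T (cb P N 0 (z, i))‖) hK0 hK
      (fun z => ‖w z‖) (fun z => norm_nonneg _) hV S (fun i u _ => hS0 i u) (fun i u _ => hS i u) Df (fun b => le_rfl)
    -- the face legs of THIS row are the new sheet, read through the differentiated column at the new rate
    have hsheet : kapF P C s δA * ∑ i : Fin nF, ∑ u ∈ F i, ‖w u‖ * ∑ i' : Ix N, ‖T (cb P N 0 (u, i'))‖
        ≤ ∑ i : Fin nF, ∑ u ∈ F i, maj P k cK1 1 (δ / 2 / P.L / 2) b₀.src u * (kapF P C s δA * ‖w u‖) := by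
      rw [Finset.mul_sum]
      refine Finset.sum_le_sum fun i _ => ?_
      rw [Finset.mul_sum]
      refine Finset.sum_le_sum fun u _ => ?_
      have hKu : ∑ i' : Ix N, ‖T (cb P N 0 (u, i'))‖ ≤ maj P k cK1 1 (δ / 2 / P.L / 2) b₀.src u :=
        (hK u).trans (maj_rate_mono hcK1 hrate _ _)
      calc kapF P C s δA * (‖w u‖ * ∑ i' : Ix N, ‖T (cb P N 0 (u, i'))‖)
          ≤ kapF P C s δA * (‖w u‖ * maj P k cK1 1 (δ / 2 / P.L / 2) b₀.src u) :=
            mul_le_mul_of_nonneg_left (mul_le_mul_of_nonneg_left hKu (norm_nonneg _)) hκF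
        _ = _ := by ring
    rw [← hT']
    refine hred.trans ?_
    linarith [hstep, hsheet]
  · -- (iv) the new sheet
    refine ⟨mul_nonneg hκF (norm_nonneg _), ?_⟩
    calc kapF P C s δA * ‖w u‖ ≤ kapF P C s δA * maj P k cv av δ u x' := mul_le_mul_of_nonneg_left (hV u) hκF
      _ = maj P k (kapF P C s δA * cv) av δ u x' := mul_maj _ _ _ _ _ _ _
      _ ≤ _ := maj_rate_mono (mul_nonneg hκF hcv) hrate u x'

/-- **THE STEP ON A BOX, NO INCOMING SHEET** (value exponent `a_v > 1`; the first insertion after a sheet-free seed such as the unit source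
`G_k(Ω,X′)e_{(x′,i′)}`, `a_v = 2`): under the hypotheses of `step_fields_box` but with `‖D^ε_Bw(b)‖ ≤ 𝔪_k(c_d,a_v−1;δ)(b₋,x′)` at the bonds
`⊂ Ω`, the same four conclusions with the constants at `c_S = 0` (`stepBoxVC(…,0,…) = stepC + n_Fκ_Fc_{K2}c_vK_F`, `stepBoxC(…,0,…) = stepC`:
the torus step `row_step_le` for the bulk, F3's `pair_face_le` for the value face legs).
[cite: Balaban1983Higgs3, (1.16) p.414, (2.5)–(2.6) p.424, (2.10) p.426, p.433] [cite: Balaban1982Higgs1, (3.16) p.615, (2.20) p.610] -/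
theorem step_fields_box_zero {δ cv cd av : ℝ} (hδ : 0 < δ) (hδδ₁ : δ ≤ δ₁) (hav : 1 < av) (hcv : 0 ≤ cv) (hcd : 0 ≤ cd)
    (w : ScalarField P 0 N) (hw : ∀ y : HiggsLattice.Site P 0, y ∉ Ω → w y = 0) (hV : ∀ y, ‖w y‖ ≤ maj P k cv av δ y x')
    (hD : ∀ b : HiggsLattice.PBond P 0, Inside Ω b → ‖covDeriv C B w b‖ ≤ maj P k cd (av - 1) δ b.src x') :
    (∀ y : HiggsLattice.Site P 0, y ∉ Ω → propagatorK C Ω X msq a k (srcV C A B k Ω a w) y = 0) ∧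
    (∀ y, ‖propagatorK C Ω X msq a k (srcV C A B k Ω a w) y‖
        ≤ maj P k (stepBoxVC P N k nF δ 2 av cK2 cv cd 0 cK1 (|C.e| * s) ((P.mesh 0)⁻¹ * (|C.e| * δA)) ((|C.e| * s) ^ 2)
            (kap4 P C k a s) (kapF P C s δA)) (2 + av - 1) (δ / 2 / P.L / 2) y x') ∧
    (∀ b₀ : HiggsLattice.PBond P 0, Inside Ω b₀ →
      ‖covDeriv C B (propagatorK C Ω X msq a k (srcV C A B k Ω a w)) b₀‖
        ≤ maj P k (stepBoxC P N k nF δ 1 av cK1 cv cd 0 cK1 (|C.e| * s) ((P.mesh 0)⁻¹ * (|C.e| * δA)) ((|C.e| * s) ^ 2)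
              (kap4 P C k a s)) (1 + av - 1) (δ / 2 / P.L / 2) b₀.src x'
          + ∑ i : Fin nF, ∑ u ∈ F i, maj P k cK1 1 (δ / 2 / P.L / 2) b₀.src u * (kapF P C s δA * ‖w u‖)) ∧
    (∀ u : HiggsLattice.Site P 0, 0 ≤ kapF P C s δA * ‖w u‖ ∧
      kapF P C s δA * ‖w u‖ ≤ maj P k (kapF P C s δA * cv) av (δ / 2 / P.L / 2) u x') := by
  have hL1 : (1 : ℝ) < (P.L : ℝ) := by exact_mod_cast hL
  have hδ1 : δ ≤ 1 := hδδ₁.trans hδ₁1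
  have hes : 0 ≤ |C.e| * s := mul_nonneg (abs_nonneg _) hs
  have hκ₂ : 0 ≤ (P.mesh 0)⁻¹ * (|C.e| * δA) := mul_nonneg (inv_nonneg.mpr (P.mesh_pos 0).le) (mul_nonneg (abs_nonneg _) hδA)
  have hκ₄ : 0 ≤ kap4 P C k a s := kap4_nonneg hs
  have hκF : 0 ≤ kapF P C s δA := kapF_nonneg hs hδA
  have hrate : δ / 2 / P.L / 2 ≤ δ := by
    rw [div_div, div_div, div_le_iff₀ (by positivity)]; nlinarith
  have hrate2 : δ / 2 / P.L / 2 ≤ δ / 2 := by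
    rw [div_div, div_le_iff₀ (by positivity)]; nlinarith
  set G : ScalarField P 0 N →ₗ[ℝ] ScalarField P 0 N := propagatorK C Ω X msq a k with hG
  set Df : HiggsLattice.PBond P 0 → ℝ := fun b => maj P k cd (av - 1) δ b.src x' with hDf
  have hDf0 : ∀ b, 0 ≤ Df b := fun b => maj_nonneg hcd _ _
  have hDfin : ∀ b ∈ inB Ω A, ‖covDeriv C B w b‖ ≤ Df b := fun b hb => hD b (mem_inB.1 hb).1
  have hsupp := propagatorK_srcV_apply_eq_zero_of_not_mem C Ω A B a hΩ X hmsq hak w hw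
  refine ⟨hsupp, fun y => ?_, fun b₀ hb₀ => ?_, fun u => ?_⟩
  · by_cases hy : y ∈ Ω
    · set T : ScalarField P 0 N →ₗ[ℝ] E N := (LinearMap.proj y : ScalarField P 0 N →ₗ[ℝ] E N) ∘ₗ G with hT
      have hT' : ∀ φ : ScalarField P 0 N, T φ = (G φ) y := fun φ => rfl
      have hTk : ∀ z : HiggsLattice.Site P 0, z ∉ Ω → ∀ v : E N, T (Pi.single z v) = 0 := fun z hz v =>
        proj_propagatorK_single_eq_zero C Ω X a hmsq hak hΩ hy hz v
      have hred := collar_row_reduce C Ω A B a hkK T hs hδA hA hregA hTk w hw Df hDf0 hDfin F hexF henF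
      have hK0 : ∀ z, 0 ≤ ∑ i : Ix N, ‖T (cb P N 0 (z, i))‖ := fun z => Finset.sum_nonneg fun _ _ => norm_nonneg _
      have hK : ∀ z, ∑ i : Ix N, ‖T (cb P N 0 (z, i))‖ ≤ maj P k cK2 2 δ y z := fun z => by
        simp only [hT', hG]
        exact (col_le_maj_all C Ω X a hmsq hak hΩ hcK2 hcolX hy z).trans (maj_rate_mono hcK2 hδδ₁ y z)
      have hbulk := row_step_le (N := N) hL hk hkK hδ hδ1 (by norm_num : (0:ℝ) < 2) hav hcK2 hcv hcd hes hκ₂ (sq_nonneg (|C.e| * s))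
        hκ₄ i₀ y x' (fun z => ∑ i : Ix N, ‖T (cb P N 0 (z, i))‖) hK0 hK (fun z => ‖w z‖) (fun z => norm_nonneg _) hV Df hDf0
        (fun b => le_rfl)
      have hface := pair_face_le hL hδ hδ1 hcK2 hcv y x' F ν c hF (fun z => ∑ i : Ix N, ‖T (cb P N 0 (z, i))‖) hK0 hK
        (fun z => ‖w z‖) (fun z => norm_nonneg _) hV (by norm_num : (1:ℝ) < 2) hav
      have hc : 0 ≤ cK2 * cv * faceK P δ 2 av := mul_nonneg (mul_nonneg hcK2 hcv) (faceK_nonneg hL hδ (by norm_num) hav)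
      have tF : kapF P C s δA * ∑ i : Fin nF, ∑ y' ∈ F i, ‖w y'‖ * ∑ i' : Ix N, ‖T (cb P N 0 (y', i'))‖
          ≤ maj P k ((nF : ℝ) * (kapF P C s δA * (cK2 * cv * faceK P δ 2 av))) (2 + av - 1) (δ / 2 / P.L / 2) y x' := by
        refine (mul_le_mul_of_nonneg_left (hface.trans (mul_le_mul_of_nonneg_left (maj_rate_mono hc hrate2 y x') (Nat.cast_nonneg _)))
          hκF).trans (le_of_eq ?_)
        rw [mul_maj, mul_maj]; ring_nf
      rw [← hT']
      refine hred.trans ((add_le_add hbulk tF).trans (le_of_eq ?_))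
      rw [maj_add, stepBoxVC_zero_sheet]
    · rw [hsupp y hy, norm_zero]
      exact maj_nonneg (stepBoxVC_zero_sheet_nonneg hL k nF hδ (by norm_num) hav hcK2 hcv hcd hes hκ₂ (sq_nonneg _) hκ₄ hκF) _ _
  · set T : ScalarField P 0 N →ₗ[ℝ] E N := covDerivAt C B b₀ ∘ₗ G with hT
    have hT' : ∀ φ : ScalarField P 0 N, T φ = covDeriv C B (G φ) b₀ := fun φ => rfl
    have hTk : ∀ z : HiggsLattice.Site P 0, z ∉ Ω → ∀ v : E N, T (Pi.single z v) = 0 := fun z hz v =>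
      covDerivAt_propagatorK_single_eq_zero C Ω X a hmsq hak hΩ B hb₀ hz v
    have hred := collar_row_reduce C Ω A B a hkK T hs hδA hA hregA hTk w hw Df hDf0 hDfin F hexF henF
    have hK0 : ∀ z, 0 ≤ ∑ i : Ix N, ‖T (cb P N 0 (z, i))‖ := fun z => Finset.sum_nonneg fun _ _ => norm_nonneg _
    have hK1 : ∀ z, ∑ i : Ix N, ‖T (cb P N 0 (z, i))‖ ≤ maj P k cK1 1 δ₁ b₀.src z := fun z => by
      simp only [hT', hG]
      exact dcol_le_maj_all C Ω X a hmsq hak hΩ B hcK1 hdcolX hb₀ z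
    have hK : ∀ z, ∑ i : Ix N, ‖T (cb P N 0 (z, i))‖ ≤ maj P k cK1 1 δ b₀.src z := fun z =>
      (hK1 z).trans (maj_rate_mono hcK1 hδδ₁ _ z)
    have hbulk := row_step_le (N := N) hL hk hkK hδ hδ1 (by norm_num : (0:ℝ) < 1) hav hcK1 hcv hcd hes hκ₂ (sq_nonneg (|C.e| * s))
      hκ₄ i₀ b₀.src x' (fun z => ∑ i : Ix N, ‖T (cb P N 0 (z, i))‖) hK0 hK (fun z => ‖w z‖) (fun z => norm_nonneg _) hV Df hDf0
      (fun b => le_rfl)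
    have hsheet : kapF P C s δA * ∑ i : Fin nF, ∑ u ∈ F i, ‖w u‖ * ∑ i' : Ix N, ‖T (cb P N 0 (u, i'))‖
        ≤ ∑ i : Fin nF, ∑ u ∈ F i, maj P k cK1 1 (δ / 2 / P.L / 2) b₀.src u * (kapF P C s δA * ‖w u‖) := by
      rw [Finset.mul_sum]
      refine Finset.sum_le_sum fun i _ => ?_
      rw [Finset.mul_sum]
      refine Finset.sum_le_sum fun u _ => ?_
      have hKu : ∑ i' : Ix N, ‖T (cb P N 0 (u, i'))‖ ≤ maj P k cK1 1 (δ / 2 / P.L / 2) b₀.src u :=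
        (hK u).trans (maj_rate_mono hcK1 hrate _ _)
      calc kapF P C s δA * (‖w u‖ * ∑ i' : Ix N, ‖T (cb P N 0 (u, i'))‖)
          ≤ kapF P C s δA * (‖w u‖ * maj P k cK1 1 (δ / 2 / P.L / 2) b₀.src u) :=
            mul_le_mul_of_nonneg_left (mul_le_mul_of_nonneg_left hKu (norm_nonneg _)) hκF
        _ = _ := by ring
    rw [← hT', stepBoxC_zero_sheet]
    refine hred.trans ?_
    linarith [hbulk, hsheet]
  · refine ⟨mul_nonneg hκF (norm_nonneg _), ?_⟩
    calc kapF P C s δA * ‖w u‖ ≤ kapF P C s δA * maj P k cv av δ u x' := mul_le_mul_of_nonneg_left (hV u) hκF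
      _ = maj P k (kapF P C s δA * cv) av δ u x' := mul_maj _ _ _ _ _ _ _
      _ ≤ _ := maj_rate_mono (mul_nonneg hκF hcv) hrate u x'

end Step

/-! ## §1 The explicit recursion of (rate, value constant, regular-derivative constant, sheet constant) -/

section Recursion

/-- **The recursion of the box state's constants** along the insertions of (1.16): seed `(δ₀, cv₀, cd₀, 0)` (no sheet), then
`(δ_J/(4L), stepBoxVC(2, 2+J, …, κ_F), stepBoxC(1, 2+J, …), κ_F·cv_J)` — the new sheet is `κ_F` times the previous values.
[cite: Balaban1983Higgs3, (1.16) p.414, (2.10) p.426, p.433] -/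
def seqB (P : HiggsLattice.Params) (N : ℕ) (C : ChargeData N) (k nF : ℕ) (a cK2 cK1 s δA δ₀ cv₀ cd₀ : ℝ) : ℕ → ℝ × ℝ × ℝ × ℝ
  | 0 => (δ₀, cv₀, cd₀, 0)
  | J + 1 =>
    ((seqB P N C k nF a cK2 cK1 s δA δ₀ cv₀ cd₀ J).1 / 2 / P.L / 2,
      stepBoxVC P N k nF (seqB P N C k nF a cK2 cK1 s δA δ₀ cv₀ cd₀ J).1 2 (2 + (J : ℝ)) cK2
        (seqB P N C k nF a cK2 cK1 s δA δ₀ cv₀ cd₀ J).2.1 (seqB P N C k nF a cK2 cK1 s δA δ₀ cv₀ cd₀ J).2.2.1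
        (seqB P N C k nF a cK2 cK1 s δA δ₀ cv₀ cd₀ J).2.2.2 cK1
        (|C.e| * s) ((P.mesh 0)⁻¹ * (|C.e| * δA)) ((|C.e| * s) ^ 2) (kap4 P C k a s) (kapF P C s δA),
      stepBoxC P N k nF (seqB P N C k nF a cK2 cK1 s δA δ₀ cv₀ cd₀ J).1 1 (2 + (J : ℝ)) cK1
        (seqB P N C k nF a cK2 cK1 s δA δ₀ cv₀ cd₀ J).2.1 (seqB P N C k nF a cK2 cK1 s δA δ₀ cv₀ cd₀ J).2.2.1
        (seqB P N C k nF a cK2 cK1 s δA δ₀ cv₀ cd₀ J).2.2.2 cK1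
        (|C.e| * s) ((P.mesh 0)⁻¹ * (|C.e| * δA)) ((|C.e| * s) ^ 2) (kap4 P C k a s),
      kapF P C s δA * (seqB P N C k nF a cK2 cK1 s δA δ₀ cv₀ cd₀ J).2.1)

/-- the rate after `J` insertions: `δ_J`. [cite: Balaban1983Higgs3, (2.10) p.426] -/
def rateB (P : HiggsLattice.Params) (N : ℕ) (C : ChargeData N) (k nF : ℕ) (a cK2 cK1 s δA δ₀ cv₀ cd₀ : ℝ) (J : ℕ) : ℝ :=
  (seqB P N C k nF a cK2 cK1 s δA δ₀ cv₀ cd₀ J).1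

/-- the value constant after `J` insertions. [cite: Balaban1983Higgs3, (1.16) p.414] -/
def cvB (P : HiggsLattice.Params) (N : ℕ) (C : ChargeData N) (k nF : ℕ) (a cK2 cK1 s δA δ₀ cv₀ cd₀ : ℝ) (J : ℕ) : ℝ :=
  (seqB P N C k nF a cK2 cK1 s δA δ₀ cv₀ cd₀ J).2.1

/-- the regular-derivative constant after `J` insertions. [cite: Balaban1983Higgs3, (1.16) p.414] -/
def cdB (P : HiggsLattice.Params) (N : ℕ) (C : ChargeData N) (k nF : ℕ) (a cK2 cK1 s δA δ₀ cv₀ cd₀ : ℝ) (J : ℕ) : ℝ :=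
  (seqB P N C k nF a cK2 cK1 s δA δ₀ cv₀ cd₀ J).2.2.1

/-- the sheet constant after `J` insertions (`cS₀ = 0`). [cite: Balaban1983Higgs3, (1.16) p.414, p.433] -/
def cSB (P : HiggsLattice.Params) (N : ℕ) (C : ChargeData N) (k nF : ℕ) (a cK2 cK1 s δA δ₀ cv₀ cd₀ : ℝ) (J : ℕ) : ℝ :=
  (seqB P N C k nF a cK2 cK1 s δA δ₀ cv₀ cd₀ J).2.2.2

variable {C : ChargeData N} {k nF : ℕ} {a cK2 cK1 s δA δ₀ cv₀ cd₀ : ℝ}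

/-- the recursion at `J = 0`. [cite: Balaban1983Higgs3, (2.10) p.426] -/
theorem seqB_zero :
    rateB P N C k nF a cK2 cK1 s δA δ₀ cv₀ cd₀ 0 = δ₀ ∧ cvB P N C k nF a cK2 cK1 s δA δ₀ cv₀ cd₀ 0 = cv₀ ∧
    cdB P N C k nF a cK2 cK1 s δA δ₀ cv₀ cd₀ 0 = cd₀ ∧ cSB P N C k nF a cK2 cK1 s δA δ₀ cv₀ cd₀ 0 = 0 :=
  ⟨rfl, rfl, rfl, rfl⟩

/-- the recursion, unfolded one step. [cite: Balaban1983Higgs3, (1.16) p.414] -/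
theorem seqB_succ (J : ℕ) :
    rateB P N C k nF a cK2 cK1 s δA δ₀ cv₀ cd₀ (J + 1) = rateB P N C k nF a cK2 cK1 s δA δ₀ cv₀ cd₀ J / 2 / P.L / 2 ∧
    cvB P N C k nF a cK2 cK1 s δA δ₀ cv₀ cd₀ (J + 1)
      = stepBoxVC P N k nF (rateB P N C k nF a cK2 cK1 s δA δ₀ cv₀ cd₀ J) 2 (2 + (J : ℝ)) cK2
          (cvB P N C k nF a cK2 cK1 s δA δ₀ cv₀ cd₀ J) (cdB P N C k nF a cK2 cK1 s δA δ₀ cv₀ cd₀ J) (cSB P N C k nF a cK2 cK1 s δA δ₀ cv₀ cd₀ J)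
          cK1 (|C.e| * s) ((P.mesh 0)⁻¹ * (|C.e| * δA)) ((|C.e| * s) ^ 2) (kap4 P C k a s) (kapF P C s δA) ∧
    cdB P N C k nF a cK2 cK1 s δA δ₀ cv₀ cd₀ (J + 1)
      = stepBoxC P N k nF (rateB P N C k nF a cK2 cK1 s δA δ₀ cv₀ cd₀ J) 1 (2 + (J : ℝ)) cK1
          (cvB P N C k nF a cK2 cK1 s δA δ₀ cv₀ cd₀ J) (cdB P N C k nF a cK2 cK1 s δA δ₀ cv₀ cd₀ J) (cSB P N C k nF a cK2 cK1 s δA δ₀ cv₀ cd₀ J)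
          cK1 (|C.e| * s) ((P.mesh 0)⁻¹ * (|C.e| * δA)) ((|C.e| * s) ^ 2) (kap4 P C k a s) ∧
    cSB P N C k nF a cK2 cK1 s δA δ₀ cv₀ cd₀ (J + 1) = kapF P C s δA * cvB P N C k nF a cK2 cK1 s δA δ₀ cv₀ cd₀ J :=
  ⟨rfl, rfl, rfl, rfl⟩

/-- positivity along the recursion: `0 < δ_J ≤ δ₁`, `cv_J, cd_J, cS_J ≥ 0` (`0 < δ₀ ≤ δ₁`; `cv₀, cd₀, c_{K2}, c_{K1}, s, δ_A ≥ 0`; `L > 1`).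
[cite: Balaban1983Higgs3, (2.10) p.426] -/
theorem seqB_pos (hL : 1 < P.L) {δ₁ : ℝ} (hδ₀ : 0 < δ₀) (hδ₀1 : δ₀ ≤ δ₁) (hcv₀ : 0 ≤ cv₀) (hcd₀ : 0 ≤ cd₀) (hcK2 : 0 ≤ cK2)
    (hcK1 : 0 ≤ cK1) (hs : 0 ≤ s) (hδA : 0 ≤ δA) (J : ℕ) :
    0 < rateB P N C k nF a cK2 cK1 s δA δ₀ cv₀ cd₀ J ∧ rateB P N C k nF a cK2 cK1 s δA δ₀ cv₀ cd₀ J ≤ δ₁ ∧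
    0 ≤ cvB P N C k nF a cK2 cK1 s δA δ₀ cv₀ cd₀ J ∧ 0 ≤ cdB P N C k nF a cK2 cK1 s δA δ₀ cv₀ cd₀ J ∧
    0 ≤ cSB P N C k nF a cK2 cK1 s δA δ₀ cv₀ cd₀ J := by
  have hL1 : (1 : ℝ) < (P.L : ℝ) := by exact_mod_cast hL
  have hes : 0 ≤ |C.e| * s := mul_nonneg (abs_nonneg _) hs
  have hκ₂ : 0 ≤ (P.mesh 0)⁻¹ * (|C.e| * δA) := mul_nonneg (inv_nonneg.mpr (P.mesh_pos 0).le) (mul_nonneg (abs_nonneg _) hδA)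
  have hκ₄ : 0 ≤ kap4 P C k a s := kap4_nonneg hs
  have hκF : 0 ≤ kapF P C s δA := kapF_nonneg hs hδA
  induction J with
  | zero =>
    obtain ⟨e1, e2, e3, e4⟩ := seqB_zero (P := P) (N := N) (C := C) (k := k) (nF := nF) (a := a) (cK2 := cK2) (cK1 := cK1) (s := s)
      (δA := δA) (δ₀ := δ₀) (cv₀ := cv₀) (cd₀ := cd₀)
    rw [e1, e2, e3, e4]
    exact ⟨hδ₀, hδ₀1, hcv₀, hcd₀, le_rfl⟩
  | succ J ih =>
    obtain ⟨h1, h2, h3, h4, h5⟩ := ih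
    obtain ⟨e1, e2, e3, e4⟩ := seqB_succ (P := P) (N := N) (C := C) (k := k) (nF := nF) (a := a) (cK2 := cK2) (cK1 := cK1) (s := s)
      (δA := δA) (δ₀ := δ₀) (cv₀ := cv₀) (cd₀ := cd₀) J
    refine ⟨?_, ?_, ?_, ?_, ?_⟩
    · rw [e1]; positivity
    · rw [e1]
      calc rateB P N C k nF a cK2 cK1 s δA δ₀ cv₀ cd₀ J / 2 / P.L / 2 ≤ rateB P N C k nF a cK2 cK1 s δA δ₀ cv₀ cd₀ J := by
            rw [div_div, div_div, div_le_iff₀ (by positivity)]; nlinarith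
        _ ≤ δ₁ := h2
    · rw [e2]
      rcases Nat.eq_zero_or_pos J with hJ | hJ
      · subst hJ
        rw [(seqB_zero (P := P) (N := N) (C := C) (k := k) (nF := nF) (a := a) (cK2 := cK2) (cK1 := cK1) (s := s) (δA := δA)
          (δ₀ := δ₀) (cv₀ := cv₀) (cd₀ := cd₀)).2.2.2]
        exact stepBoxVC_zero_sheet_nonneg hL k nF h1 (by norm_num) (by norm_num) hcK2 h3 h4 hes hκ₂ (sq_nonneg _) hκ₄ hκF
      · have hJ2 : (2 : ℝ) < 2 + (J : ℝ) := by
          have h0J : (0 : ℝ) < (J : ℝ) := Nat.cast_pos.mpr hJ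
          linarith
        exact stepBoxVC_nonneg hL k nF h1 (by norm_num) hJ2 hcK2 h3 h4 h5 hcK1 hes hκ₂ (sq_nonneg _) hκ₄ hκF
    · rw [e3]
      rcases Nat.eq_zero_or_pos J with hJ | hJ
      · subst hJ
        rw [(seqB_zero (P := P) (N := N) (C := C) (k := k) (nF := nF) (a := a) (cK2 := cK2) (cK1 := cK1) (s := s) (δA := δA)
          (δ₀ := δ₀) (cv₀ := cv₀) (cd₀ := cd₀)).2.2.2, stepBoxC_zero_sheet]
        exact B3Op116MajorantStep.stepC_nonneg hL k h1 (by norm_num) (by norm_num) hcK1 h3 h4 hes hκ₂ (sq_nonneg _) hκ₄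
      · have hJ2 : (2 : ℝ) < 2 + (J : ℝ) := by
          have h0J : (0 : ℝ) < (J : ℝ) := Nat.cast_pos.mpr hJ
          linarith
        exact stepBoxC_nonneg hL k nF h1 (by norm_num) hJ2 hcK1 h3 h4 h5 hcK1 hes hκ₂ (sq_nonneg _) hκ₄
    · rw [e4]; exact mul_nonneg hκF h3

/-- closed form of the rate: `δ_M = δ₀/(4L)^M`. [cite: Balaban1983Higgs3, (2.10) p.426] -/
theorem rateB_closed (M : ℕ) : rateB P N C k nF a cK2 cK1 s δA δ₀ cv₀ cd₀ M = δ₀ / (4 * (P.L : ℝ)) ^ M := by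
  induction M with
  | zero =>
    rw [(seqB_zero (P := P) (N := N) (C := C) (k := k) (nF := nF) (a := a) (cK2 := cK2) (cK1 := cK1) (s := s) (δA := δA)
      (δ₀ := δ₀) (cv₀ := cv₀) (cd₀ := cd₀)).1, pow_zero, div_one]
  | succ M ih =>
    rw [(seqB_succ (P := P) (N := N) (C := C) (k := k) (nF := nF) (a := a) (cK2 := cK2) (cK1 := cK1) (s := s) (δA := δA)
      (δ₀ := δ₀) (cv₀ := cv₀) (cd₀ := cd₀) M).1, ih, pow_succ]
    have hL : (P.L : ℝ) ≠ 0 := by have := P.hL; positivity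
    field_simp
    ring

end Recursion

/-! ## §2 The three-component state and the step on it -/

section State

/-- **THE THREE-COMPONENT MAJORANT STATE of a field on `Ω`** (a predicate on fields `w`; data: the derivative background `B`, the face family `F`,
the constant `c_{K1}` of the differentiated column, the anchor `x′`, the value exponent `a_v` and the constants `(δ, c_v, c_d, c_S)`):
`w` vanishes off `Ω`; `‖w(y)‖ ≤ 𝔪_k(c_v,a_v;δ)(y,x′)` everywhere; and for SOME sheet `0 ≤ S ≤ 𝔪_k(c_S,a_v−1;δ)(·,x′)`, at every bond `b ⊂ Ω`,
`‖D^ε_Bw(b)‖ ≤ 𝔪_k(c_d,a_v−1;δ)(b₋,x′) + Σ_iΣ_{u∈F_i}𝔪_k(c_{K1},1;δ)(b₋,u)S(u)` (p35 `DESIGN-FILE4.md` §14 (d) / §15).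
[cite: Balaban1983Higgs3, (1.16) p.414, (2.10) p.426, p.433] -/
def BoxState (C : ChargeData N) (Ω : Finset (HiggsLattice.Site P 0)) (B : HiggsLattice.VecField P 0) (k : ℕ) {nF : ℕ}
    (F : Fin nF → Finset (HiggsLattice.Site P 0)) (cK1 : ℝ) (x' : HiggsLattice.Site P 0) (av δ cv cd cS : ℝ) (w : ScalarField P 0 N) : Prop :=
  (∀ y : HiggsLattice.Site P 0, y ∉ Ω → w y = 0) ∧ (∀ y, ‖w y‖ ≤ maj P k cv av δ y x') ∧
  ∃ S : HiggsLattice.Site P 0 → ℝ, (∀ u, 0 ≤ S u ∧ S u ≤ maj P k cS (av - 1) δ u x') ∧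
    ∀ b : HiggsLattice.PBond P 0, Inside Ω b →
      ‖covDeriv C B w b‖ ≤ maj P k cd (av - 1) δ b.src x' + ∑ i : Fin nF, ∑ u ∈ F i, maj P k cK1 1 δ b.src u * S u

variable {C : ChargeData N} {Ω : Finset (HiggsLattice.Site P 0)} {A B : HiggsLattice.VecField P 0} {msq a : ℝ} {k : ℕ}
  {δ₁ s δA cK2 cK1 δ₀ cv₀ cd₀ : ℝ} {nF : ℕ} {F : Fin nF → Finset (HiggsLattice.Site P 0)} {ν : Fin nF → Fin P.d}
  {c : (i : Fin nF) → ZMod (P.sitesPerDir 0 (ν i))}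

/-- a SHEET-FREE state (`c_S = 0`; exponents `2`/`1`, rate `δ₀`) is the state `0` of the recursion. [cite: Balaban1983Higgs3, (2.10) p.426] -/
theorem boxState_zero_of_sheet_free (x' : HiggsLattice.Site P 0) (w : ScalarField P 0 N)
    (hsupp : ∀ y : HiggsLattice.Site P 0, y ∉ Ω → w y = 0) (hV : ∀ y, ‖w y‖ ≤ maj P k cv₀ 2 δ₀ y x')
    (hD : ∀ b : HiggsLattice.PBond P 0, Inside Ω b → ‖covDeriv C B w b‖ ≤ maj P k cd₀ 1 δ₀ b.src x') :
    BoxState C Ω B k F cK1 x' (2 + ((0 : ℕ) : ℝ)) (rateB P N C k nF a cK2 cK1 s δA δ₀ cv₀ cd₀ 0) (cvB P N C k nF a cK2 cK1 s δA δ₀ cv₀ cd₀ 0)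
      (cdB P N C k nF a cK2 cK1 s δA δ₀ cv₀ cd₀ 0) (cSB P N C k nF a cK2 cK1 s δA δ₀ cv₀ cd₀ 0) w := by
  obtain ⟨e1, e2, e3, e4⟩ := seqB_zero (P := P) (N := N) (C := C) (k := k) (nF := nF) (a := a) (cK2 := cK2) (cK1 := cK1) (s := s)
    (δA := δA) (δ₀ := δ₀) (cv₀ := cv₀) (cd₀ := cd₀)
  rw [e1, e2, e3, e4, Nat.cast_zero, add_zero]
  refine ⟨hsupp, hV, fun _ => 0, fun u => ⟨le_rfl, by simp [maj]⟩, fun b hb => ?_⟩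
  rw [show (2 : ℝ) - 1 = 1 by norm_num]
  simpa using hD b hb

variable (hL : 1 < P.L) (hk : 1 ≤ k) (hkK : k ≤ P.K) (hmsq : 0 < msq) (hak : 0 ≤ B1.aSeq a P.L k)
  (hΩ : ∀ x x' : HiggsLattice.Site P 0, blockIter k x = blockIter k x' → (x ∈ Ω ↔ x' ∈ Ω))
  (hcK2 : 0 ≤ cK2) (hcK1 : 0 ≤ cK1)
  (hcolB : ∀ x ∈ Ω, ∀ z ∈ Ω, ∑ i : Ix N, ‖propagatorK C Ω B msq a k (cb P N 0 (z, i)) x‖ ≤ maj P k cK2 2 δ₁ x z)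
  (hdcolB : ∀ b : HiggsLattice.PBond P 0, Inside Ω b → ∀ z ∈ Ω,
    ∑ i : Ix N, ‖covDeriv C B (propagatorK C Ω B msq a k (cb P N 0 (z, i))) b‖ ≤ maj P k cK1 1 δ₁ b.src z)
  (hcolAB : ∀ x ∈ Ω, ∀ z ∈ Ω, ∑ i : Ix N, ‖propagatorK C Ω (A + B) msq a k (cb P N 0 (z, i)) x‖ ≤ maj P k cK2 2 δ₁ x z)
  (hdcolAB : ∀ b : HiggsLattice.PBond P 0, Inside Ω b → ∀ z ∈ Ω,
    ∑ i : Ix N, ‖covDeriv C B (propagatorK C Ω (A + B) msq a k (cb P N 0 (z, i))) b‖ ≤ maj P k cK1 1 δ₁ b.src z)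
  (hδ₁1 : δ₁ ≤ 1) (hs : 0 ≤ s) (hA : ∀ b : HiggsLattice.PBond P 0, |A b| ≤ s) (hδA : 0 ≤ δA)
  (hregA : ∀ (z : HiggsLattice.Site P 0) (μ ν : Fin P.d), |A ⟨z.shift ν, μ⟩ - A ⟨z, μ⟩| ≤ δA)
  (i₀ : Ix N) (hF : ∀ i, ∀ u ∈ F i, u (ν i) = c i)
  (hexF : ∀ b ∈ exB Ω A, ∃ i : Fin nF, b.src ∈ F i) (henF : ∀ b ∈ enB Ω A, ∃ i : Fin nF, b.tgt ∈ F i)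
  (hδ₀ : 0 < δ₀) (hδ₀1 : δ₀ ≤ δ₁) (hcv₀ : 0 ≤ cv₀) (hcd₀ : 0 ≤ cd₀) (x' : HiggsLattice.Site P 0)
include hL hk hkK hmsq hak hΩ hcK2 hcK1 hcolB hdcolB hcolAB hdcolAB hδ₁1 hs hA hδA hregA i₀ hF hexF henF hδ₀ hδ₀1 hcv₀ hcd₀

/-- **THE STEP ON THE STATE**: if `w` is in the state `J` (exponent `2 + J`, constants `seqB J`), then `G_k(Ω,X)V_k^Ω(A,B)w` is in the state
`J + 1`, for `X = B` and for `X = A + B` — `J = 0`: the sheet constant `cS₀ = 0` forces the sheet to vanish and `step_fields_box_zero` applies;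
`J ≥ 1`: `step_fields_box`. [cite: Balaban1983Higgs3, (1.16) p.414, (2.10) p.426, p.433] [cite: Balaban1982Higgs1, (3.16) p.615] -/
theorem step_state_box (J : ℕ) (w : ScalarField P 0 N)
    (hw : BoxState C Ω B k F cK1 x' (2 + (J : ℝ)) (rateB P N C k nF a cK2 cK1 s δA δ₀ cv₀ cd₀ J) (cvB P N C k nF a cK2 cK1 s δA δ₀ cv₀ cd₀ J)
      (cdB P N C k nF a cK2 cK1 s δA δ₀ cv₀ cd₀ J) (cSB P N C k nF a cK2 cK1 s δA δ₀ cv₀ cd₀ J) w)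
    (X : HiggsLattice.VecField P 0) (hX : X = B ∨ X = A + B) :
    BoxState C Ω B k F cK1 x' (2 + ((J + 1 : ℕ) : ℝ)) (rateB P N C k nF a cK2 cK1 s δA δ₀ cv₀ cd₀ (J + 1))
      (cvB P N C k nF a cK2 cK1 s δA δ₀ cv₀ cd₀ (J + 1)) (cdB P N C k nF a cK2 cK1 s δA δ₀ cv₀ cd₀ (J + 1))
      (cSB P N C k nF a cK2 cK1 s δA δ₀ cv₀ cd₀ (J + 1)) (propagatorK C Ω X msq a k (srcV C A B k Ω a w)) := by
  obtain ⟨hr0, hrδ, hcv0, hcd0, hcS0⟩ := seqB_pos (P := P) (N := N) (C := C) (k := k) (nF := nF) (a := a) (cK2 := cK2) (cK1 := cK1)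
    (s := s) (δA := δA) (δ₀ := δ₀) (cv₀ := cv₀) (cd₀ := cd₀) hL hδ₀ hδ₀1 hcv₀ hcd₀ hcK2 hcK1 hs hδA J
  obtain ⟨e1, e2, e3, e4⟩ := seqB_succ (P := P) (N := N) (C := C) (k := k) (nF := nF) (a := a) (cK2 := cK2) (cK1 := cK1) (s := s)
    (δA := δA) (δ₀ := δ₀) (cv₀ := cv₀) (cd₀ := cd₀) J
  obtain ⟨hsupp, hV, Sf, hSf, hD⟩ := hw
  -- kernel dictionary for X
  have hcolX : ∀ x ∈ Ω, ∀ z ∈ Ω, ∑ i : Ix N, ‖propagatorK C Ω X msq a k (cb P N 0 (z, i)) x‖ ≤ maj P k cK2 2 δ₁ x z := by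
    rcases hX with rfl | rfl
    exacts [hcolB, hcolAB]
  have hdcolX : ∀ b : HiggsLattice.PBond P 0, Inside Ω b → ∀ z ∈ Ω,
      ∑ i : Ix N, ‖covDeriv C B (propagatorK C Ω X msq a k (cb P N 0 (z, i))) b‖ ≤ maj P k cK1 1 δ₁ b.src z := by
    rcases hX with rfl | rfl
    exacts [hdcolB, hdcolAB]
  have ev : (2 : ℝ) + (2 + (J : ℝ)) - 1 = 2 + ((J + 1 : ℕ) : ℝ) := by push_cast; ring
  have ed : (1 : ℝ) + (2 + (J : ℝ)) - 1 = 2 + ((J + 1 : ℕ) : ℝ) - 1 := by push_cast; ring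
  have es : (2 : ℝ) + (J : ℝ) = 2 + ((J + 1 : ℕ) : ℝ) - 1 := by push_cast; ring
  rcases Nat.eq_zero_or_pos J with hJ | hJ
  · -- J = 0: the sheet vanishes
    subst hJ
    have hS00 : cSB P N C k nF a cK2 cK1 s δA δ₀ cv₀ cd₀ 0 = 0 := rfl
    have hSf0 : ∀ u, Sf u = 0 := fun u => by
      have h := (hSf u).2
      rw [hS00] at h
      have h0 : maj P k 0 (2 + ((0 : ℕ) : ℝ) - 1) (rateB P N C k nF a cK2 cK1 s δA δ₀ cv₀ cd₀ 0) u x' = 0 := by simp [maj]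
      exact le_antisymm (h.trans h0.le) (hSf u).1
    have hD' : ∀ b : HiggsLattice.PBond P 0, Inside Ω b →
        ‖covDeriv C B w b‖ ≤ maj P k (cdB P N C k nF a cK2 cK1 s δA δ₀ cv₀ cd₀ 0) (2 + ((0 : ℕ) : ℝ) - 1)
          (rateB P N C k nF a cK2 cK1 s δA δ₀ cv₀ cd₀ 0) b.src x' := fun b hb => by
      have h := hD b hb
      simp only [hSf0, mul_zero, Finset.sum_const_zero, add_zero] at h
      exact h
    obtain ⟨h1, h2, h3, h4⟩ := step_fields_box_zero (X := X) hL hk hkK hmsq hak hΩ hcK2 hcK1 hcolX hdcolX hδ₁1 hs hA hδA hregA i₀ x' F ν c hF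
      hexF henF hr0 hrδ (by norm_num) hcv0 hcd0 w hsupp hV hD'
    rw [hS00] at e2 e3
    refine ⟨h1, fun y => ?_, fun u => kapF P C s δA * ‖w u‖, fun u => ⟨(h4 u).1, ?_⟩, fun b hb => ?_⟩
    · have h := h2 y; rw [ev, ← e1, ← e2] at h; exact h
    · have h := (h4 u).2; rw [es, ← e1, ← e4] at h; exact h
    · have h := h3 b hb; rw [ed, ← e1, ← e3] at h; exact h
  · have hJ2 : (2 : ℝ) < 2 + (J : ℝ) := by
      have h0J : (0 : ℝ) < (J : ℝ) := Nat.cast_pos.mpr hJ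
      linarith
    obtain ⟨h1, h2, h3, h4⟩ := step_fields_box (X := X) hL hk hkK hmsq hak hΩ hcK2 hcK1 hcolX hdcolX hδ₁1 hs hA hδA hregA i₀ x' F ν c hF
      hexF henF hr0 hrδ hJ2 hcv0 hcd0 hcS0 w hsupp hV (fun _ => Sf) (fun _ u => (hSf u).1) (fun _ u => (hSf u).2) hD
    refine ⟨h1, fun y => ?_, fun u => kapF P C s δA * ‖w u‖, fun u => ⟨(h4 u).1, ?_⟩, fun b hb => ?_⟩
    · have h := h2 y; rw [ev, ← e1, ← e2] at h; exact h
    · have h := (h4 u).2; rw [es, ← e1, ← e4] at h; exact h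
    · have h := h3 b hb; rw [ed, ← e1, ← e3] at h; exact h

/-- **THE INDUCTION OVER THE INSERTIONS OF (1.16) ON `Ω`.**  If both images `G_k(Ω,B)ψ`, `G_k(Ω,A+B)ψ` of a source `ψ` are in the state `J`,
then `(1.16)^Ω_{n,n′}ψ = [G_k(Ω,B)V_k^Ω]^nG_k(Ω,A+B)[V_k^ΩG_k(Ω,B)]^{n′}ψ` is in the state `J + (n + n′)` — induction on `n′` by r14's
`op116_succ_right_apply`, on `n` by `op116_succ_left_apply`, base `op116_zero_zero_apply`; the torus proof of
`B3Op116DKernelRegularTorus.state_op116` verbatim with `T_ε ↦ Ω`. [cite: Balaban1983Higgs3, (1.16) p.414, (2.10) p.426, p.433] -/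
theorem state_op116_box : ∀ (n' n J : ℕ) (ψ : ScalarField P 0 N),
    (∀ X : HiggsLattice.VecField P 0, (X = B ∨ X = A + B) →
      BoxState C Ω B k F cK1 x' (2 + (J : ℝ)) (rateB P N C k nF a cK2 cK1 s δA δ₀ cv₀ cd₀ J) (cvB P N C k nF a cK2 cK1 s δA δ₀ cv₀ cd₀ J)
        (cdB P N C k nF a cK2 cK1 s δA δ₀ cv₀ cd₀ J) (cSB P N C k nF a cK2 cK1 s δA δ₀ cv₀ cd₀ J) (propagatorK C Ω X msq a k ψ)) →
    BoxState C Ω B k F cK1 x' (2 + ((J + (n + n') : ℕ) : ℝ)) (rateB P N C k nF a cK2 cK1 s δA δ₀ cv₀ cd₀ (J + (n + n')))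
      (cvB P N C k nF a cK2 cK1 s δA δ₀ cv₀ cd₀ (J + (n + n'))) (cdB P N C k nF a cK2 cK1 s δA δ₀ cv₀ cd₀ (J + (n + n')))
      (cSB P N C k nF a cK2 cK1 s δA δ₀ cv₀ cd₀ (J + (n + n'))) (op116 C Ω A B msq a k n n' ψ) := by
  intro n'
  induction n' with
  | zero =>
    intro n
    induction n with
    | zero =>
      intro J ψ hψ
      have h := hψ (A + B) (Or.inr rfl)
      simp only [Nat.add_zero, op116_zero_zero_apply]
      exact h
    | succ n ihn =>
      intro J ψ hψ
      have ih := ihn J ψ hψ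
      have e : J + (n + 1 + 0) = (J + (n + 0)) + 1 := by omega
      rw [e]
      simp only [op116_succ_left_apply]
      exact step_state_box hL hk hkK hmsq hak hΩ hcK2 hcK1 hcolB hdcolB hcolAB hdcolAB hδ₁1 hs hA hδA hregA i₀ hF hexF henF hδ₀ hδ₀1 hcv₀
        hcd₀ x' (J + (n + 0)) _ ih B (Or.inl rfl)
  | succ n' ih =>
    intro n J ψ hψ
    have hB := hψ B (Or.inl rfl)
    have hψ' : ∀ X : HiggsLattice.VecField P 0, (X = B ∨ X = A + B) →
        BoxState C Ω B k F cK1 x' (2 + ((J + 1 : ℕ) : ℝ)) (rateB P N C k nF a cK2 cK1 s δA δ₀ cv₀ cd₀ (J + 1))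
          (cvB P N C k nF a cK2 cK1 s δA δ₀ cv₀ cd₀ (J + 1)) (cdB P N C k nF a cK2 cK1 s δA δ₀ cv₀ cd₀ (J + 1))
          (cSB P N C k nF a cK2 cK1 s δA δ₀ cv₀ cd₀ (J + 1))
          (propagatorK C Ω X msq a k (srcV C A B k Ω a (propagatorK C Ω B msq a k ψ))) :=
      fun X hX => step_state_box hL hk hkK hmsq hak hΩ hcK2 hcK1 hcolB hdcolB hcolAB hdcolAB hδ₁1 hs hA hδA hregA i₀ hF hexF henF hδ₀ hδ₀1
        hcv₀ hcd₀ x' J _ hB X hX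
    have h := ih n (J + 1) _ hψ'
    have e : J + (n + (n' + 1)) = J + 1 + (n + n') := by omega
    rw [e]
    simp only [op116_succ_right_apply]
    exact h

end State

/-! ## §4 (§3 = `state_op116_box` above) The unit sources: `e_{(x′,i′)}` with `x′ ∈ Ω` is in the state `0` of the seed `(δ₁, c_{K2}, c_{K1}, 0)` -/

section UnitSource

variable {C : ChargeData N} {Ω : Finset (HiggsLattice.Site P 0)} {A B : HiggsLattice.VecField P 0} {msq a : ℝ} {k : ℕ}
  {δ₁ s δA cK2 cK1 : ℝ} {nF : ℕ} {F : Fin nF → Finset (HiggsLattice.Site P 0)} {ν : Fin nF → Fin P.d}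
  {c : (i : Fin nF) → ZMod (P.sitesPerDir 0 (ν i))}

variable (hL : 1 < P.L) (hk : 1 ≤ k) (hkK : k ≤ P.K) (hmsq : 0 < msq) (hak : 0 ≤ B1.aSeq a P.L k)
  (hΩ : ∀ x x' : HiggsLattice.Site P 0, blockIter k x = blockIter k x' → (x ∈ Ω ↔ x' ∈ Ω))
  (hcK2 : 0 ≤ cK2) (hcK1 : 0 ≤ cK1)
  (hcolB : ∀ x ∈ Ω, ∀ z ∈ Ω, ∑ i : Ix N, ‖propagatorK C Ω B msq a k (cb P N 0 (z, i)) x‖ ≤ maj P k cK2 2 δ₁ x z)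
  (hdcolB : ∀ b : HiggsLattice.PBond P 0, Inside Ω b → ∀ z ∈ Ω,
    ∑ i : Ix N, ‖covDeriv C B (propagatorK C Ω B msq a k (cb P N 0 (z, i))) b‖ ≤ maj P k cK1 1 δ₁ b.src z)
  (hcolAB : ∀ x ∈ Ω, ∀ z ∈ Ω, ∑ i : Ix N, ‖propagatorK C Ω (A + B) msq a k (cb P N 0 (z, i)) x‖ ≤ maj P k cK2 2 δ₁ x z)
  (hdcolAB : ∀ b : HiggsLattice.PBond P 0, Inside Ω b → ∀ z ∈ Ω,
    ∑ i : Ix N, ‖covDeriv C B (propagatorK C Ω (A + B) msq a k (cb P N 0 (z, i))) b‖ ≤ maj P k cK1 1 δ₁ b.src z)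
  (hδ₁ : 0 < δ₁) (hδ₁1 : δ₁ ≤ 1) (hs : 0 ≤ s) (hA : ∀ b : HiggsLattice.PBond P 0, |A b| ≤ s) (hδA : 0 ≤ δA)
  (hregA : ∀ (z : HiggsLattice.Site P 0) (μ ν : Fin P.d), |A ⟨z.shift ν, μ⟩ - A ⟨z, μ⟩| ≤ δA)
  (i₀ : Ix N) (hF : ∀ i, ∀ u ∈ F i, u (ν i) = c i)
  (hexF : ∀ b ∈ exB Ω A, ∃ i : Fin nF, b.src ∈ F i) (henF : ∀ b ∈ enB Ω A, ∃ i : Fin nF, b.tgt ∈ F i)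
  {x' : HiggsLattice.Site P 0} (hx' : x' ∈ Ω)
include hL hk hkK hmsq hak hΩ hcK2 hcK1 hcolB hdcolB hcolAB hdcolAB hδ₁ hδ₁1 hs hA hδA hregA i₀ hF hexF henF hx'

omit hL hk hkK hcK1 hδ₁ hδ₁1 hs hA hδA hregA i₀ hF hexF henF in
/-- **THE UNIT SOURCES ARE IN THE STATE 0** (`x′ ∈ Ω`): `G_k(Ω,X)e_{(x′,i′)}` vanishes off `Ω` (block-diagonality), `‖(G_k(Ω,X)e_{(x′,i′)})(y)‖ ≤ κ_X(y,x′)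
≤ 𝔪_k(c_{K2},2;δ₁)(y,x′)`, `‖(D^ε_BG_k(Ω,X)e_{(x′,i′)})(b)‖ ≤ κ^D_{B,X}(b,x′) ≤ 𝔪_k(c_{K1},1;δ₁)(b₋,x′)` at `b ⊂ Ω`, no sheet.
[cite: Balaban1983Higgs3, (2.10) p.426] [cite: Balaban1982Higgs1, (2.20) p.610] -/
theorem base_state_box (i' : Ix N) (X : HiggsLattice.VecField P 0) (hX : X = B ∨ X = A + B) :
    BoxState C Ω B k F cK1 x' (2 + ((0 : ℕ) : ℝ)) (rateB P N C k nF a cK2 cK1 s δA δ₁ cK2 cK1 0) (cvB P N C k nF a cK2 cK1 s δA δ₁ cK2 cK1 0)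
      (cdB P N C k nF a cK2 cK1 s δA δ₁ cK2 cK1 0) (cSB P N C k nF a cK2 cK1 s δA δ₁ cK2 cK1 0)
      (propagatorK C Ω X msq a k (cb P N 0 (x', i'))) := by
  have hcolX : ∀ x ∈ Ω, ∀ z ∈ Ω, ∑ i : Ix N, ‖propagatorK C Ω X msq a k (cb P N 0 (z, i)) x‖ ≤ maj P k cK2 2 δ₁ x z := by
    rcases hX with rfl | rfl
    exacts [hcolB, hcolAB]
  have hdcolX : ∀ b : HiggsLattice.PBond P 0, Inside Ω b → ∀ z ∈ Ω,
      ∑ i : Ix N, ‖covDeriv C B (propagatorK C Ω X msq a k (cb P N 0 (z, i))) b‖ ≤ maj P k cK1 1 δ₁ b.src z := by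
    rcases hX with rfl | rfl
    exacts [hdcolB, hdcolAB]
  have hsupp : ∀ y : HiggsLattice.Site P 0, y ∉ Ω → propagatorK C Ω X msq a k (cb P N 0 (x', i')) y = 0 :=
    fun y hy => propagatorK_cb_apply_eq_zero_of_mem C Ω X a hmsq hak hΩ hx' hy i'
  refine boxState_zero_of_sheet_free x' _ hsupp (fun y => ?_) (fun b hb => ?_)
  · by_cases hy : y ∈ Ω
    · refine le_trans ?_ (hcolX y hy x' hx')
      exact Finset.single_le_sum (s := Finset.univ) (f := fun i => ‖propagatorK C Ω X msq a k (cb P N 0 (x', i)) y‖)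
        (fun i _ => norm_nonneg _) (Finset.mem_univ i')
    · rw [hsupp y hy, norm_zero]; exact maj_nonneg hcK2 _ _
  · refine le_trans ?_ (hdcolX b hb x' hx')
    exact Finset.single_le_sum (s := Finset.univ) (f := fun i => ‖covDeriv C B (propagatorK C Ω X msq a k (cb P N 0 (x', i))) b‖)
      (fun i _ => norm_nonneg _) (Finset.mem_univ i')

/-- **THE FIELD `(1.16)^Ω_{n,n′}e_{(x′,i′)}` IS IN THE STATE `n + n′`** (`x′ ∈ Ω`; seed `(δ₁, c_{K2}, c_{K1}, 0)`).
[cite: Balaban1983Higgs3, (1.16) p.414, (2.10) p.426, p.433] -/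
theorem state_op116_box_cb (n n' : ℕ) (i' : Ix N) :
    BoxState C Ω B k F cK1 x' (2 + ((n + n' : ℕ) : ℝ)) (rateB P N C k nF a cK2 cK1 s δA δ₁ cK2 cK1 (n + n'))
      (cvB P N C k nF a cK2 cK1 s δA δ₁ cK2 cK1 (n + n')) (cdB P N C k nF a cK2 cK1 s δA δ₁ cK2 cK1 (n + n'))
      (cSB P N C k nF a cK2 cK1 s δA δ₁ cK2 cK1 (n + n')) (op116 C Ω A B msq a k n n' (cb P N 0 (x', i'))) := by
  have h := state_op116_box hL hk hkK hmsq hak hΩ hcK2 hcK1 hcolB hdcolB hcolAB hdcolAB hδ₁1 hs hA hδA hregA i₀ hF hexF henF hδ₁ le_rfl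
    hcK2 hcK1 x' n' n 0 (cb P N 0 (x', i')) (fun X hX => base_state_box hmsq hak hΩ hcK2 hcolB hdcolB hcolAB hdcolAB hx' i' X hX)
  simp only [Nat.zero_add] at h
  exact h

end UnitSource

/-! ## §5 The theorems: the kernel of (1.16) on `Ω` at every point, and its row derivative at the bonds of `Ω` up to the end sheet -/

section Kernel

/-- the value constant of `kernel116_value_box_le`: `ε^{−d}·N·cvB(M)/(L^{M+2−d} − 1)`. [cite: Balaban1983Higgs3, (1.16) p.414] -/
def valCB (P : HiggsLattice.Params) (N : ℕ) (C : ChargeData N) (k nF : ℕ) (a cK2 cK1 s δA δ₁ : ℝ) (M : ℕ) : ℝ :=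
  (P.mesh 0 ^ P.d)⁻¹ * (Fintype.card (Ix N) : ℝ) *
    (cvB P N C k nF a cK2 cK1 s δA δ₁ cK2 cK1 M / ((P.L : ℝ) ^ ((2 : ℝ) + (M : ℝ) - (P.d : ℝ)) - 1))

/-- the regular-derivative constant of `kernel116_deriv_box_le`: `ε^{−d}·N·cdB(M)/(L^{M+1−d} − 1)`. [cite: Balaban1983Higgs3, (1.16) p.414] -/
def derCB (P : HiggsLattice.Params) (N : ℕ) (C : ChargeData N) (k nF : ℕ) (a cK2 cK1 s δA δ₁ : ℝ) (M : ℕ) : ℝ :=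
  (P.mesh 0 ^ P.d)⁻¹ * (Fintype.card (Ix N) : ℝ) *
    (cdB P N C k nF a cK2 cK1 s δA δ₁ cK2 cK1 M / ((P.L : ℝ) ^ ((1 : ℝ) + (M : ℝ) - (P.d : ℝ)) - 1))

variable {C : ChargeData N} {Ω : Finset (HiggsLattice.Site P 0)} {A B : HiggsLattice.VecField P 0} {msq a : ℝ} {k : ℕ}
  {δ₁ s δA cK2 cK1 : ℝ} {nF : ℕ} {F : Fin nF → Finset (HiggsLattice.Site P 0)} {ν : Fin nF → Fin P.d}
  {c : (i : Fin nF) → ZMod (P.sitesPerDir 0 (ν i))}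

variable (hL : 1 < P.L) (hk : 1 ≤ k) (hkK : k ≤ P.K) (hmsq : 0 < msq) (hak : 0 ≤ B1.aSeq a P.L k)
  (hΩ : ∀ x x' : HiggsLattice.Site P 0, blockIter k x = blockIter k x' → (x ∈ Ω ↔ x' ∈ Ω))
  (hcK2 : 0 ≤ cK2) (hcK1 : 0 ≤ cK1)
  (hcolB : ∀ x ∈ Ω, ∀ z ∈ Ω, ∑ i : Ix N, ‖propagatorK C Ω B msq a k (cb P N 0 (z, i)) x‖ ≤ maj P k cK2 2 δ₁ x z)
  (hdcolB : ∀ b : HiggsLattice.PBond P 0, Inside Ω b → ∀ z ∈ Ω,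
    ∑ i : Ix N, ‖covDeriv C B (propagatorK C Ω B msq a k (cb P N 0 (z, i))) b‖ ≤ maj P k cK1 1 δ₁ b.src z)
  (hcolAB : ∀ x ∈ Ω, ∀ z ∈ Ω, ∑ i : Ix N, ‖propagatorK C Ω (A + B) msq a k (cb P N 0 (z, i)) x‖ ≤ maj P k cK2 2 δ₁ x z)
  (hdcolAB : ∀ b : HiggsLattice.PBond P 0, Inside Ω b → ∀ z ∈ Ω,
    ∑ i : Ix N, ‖covDeriv C B (propagatorK C Ω (A + B) msq a k (cb P N 0 (z, i))) b‖ ≤ maj P k cK1 1 δ₁ b.src z)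
  (hδ₁ : 0 < δ₁) (hδ₁1 : δ₁ ≤ 1) (hs : 0 ≤ s) (hA : ∀ b : HiggsLattice.PBond P 0, |A b| ≤ s) (hδA : 0 ≤ δA)
  (hregA : ∀ (z : HiggsLattice.Site P 0) (μ ν : Fin P.d), |A ⟨z.shift ν, μ⟩ - A ⟨z, μ⟩| ≤ δA)
  (i₀ : Ix N) (hF : ∀ i, ∀ u ∈ F i, u (ν i) = c i)
  (hexF : ∀ b ∈ exB Ω A, ∃ i : Fin nF, b.src ∈ F i) (henF : ∀ b ∈ enB Ω A, ∃ i : Fin nF, b.tgt ∈ F i)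
  {x' : HiggsLattice.Site P 0} (hx' : x' ∈ Ω)
include hL hk hkK hmsq hak hΩ hcK2 hcK1 hcolB hdcolB hcolAB hdcolAB hδ₁ hδ₁1 hs hA hδA hregA i₀ hF hexF henF hx'

/-- **THE KERNEL OF (1.16) ON `Ω` IS UNIFORMLY BOUNDED AND EXPONENTIALLY DECAYING AT EVERY POINT, FOR ALL `n + n′ + 2 > d`** (print's *"uniformly
bounded … exponentially decaying with the distance of the arguments"*, p. 414, VALUE of the kernel; source `x′` anywhere in `Ω`, row point `x`
anywhere — off `Ω` the kernel vanishes): `ε^{−d}Σ_{i′}‖((1.16)^Ω_{n,n′}e_{(x′,i′)})(x)‖ ≤ valCB(n+n′)·(L^kε)^{n+n′}·((L^kε)²((L^kε)^d)^{−1})·e^{−δ_{n+n′}|x−x′|/L^k}`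
with `δ_M = δ₁/(4L)^M` — the shape of p40's binder `hV` of `B3Ineq25Op116SmoothInner.ineq25At_op116_smooth_of_bounds_inner` with `Good := ` every
point; NO support clause on `A`, no margin. [cite: Balaban1983Higgs3, (1.16) p.414, (2.5) p.424, (2.10) p.426, p.433] [cite: Balaban1982Higgs1, (3.16) p.615] -/
theorem kernel116_value_box_le (n n' : ℕ) (hd : (P.d : ℝ) < (n + n' : ℕ) + 2) (x : HiggsLattice.Site P 0) :
    (P.mesh 0 ^ P.d)⁻¹ * ∑ i' : Ix N, ‖op116 C Ω A B msq a k n n' (cb P N 0 (x', i')) x‖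
      ≤ valCB P N C k nF a cK2 cK1 s δA δ₁ (n + n') * P.mesh k ^ (n + n') * (P.mesh k ^ 2 * (P.mesh k ^ P.d)⁻¹) *
          Real.exp (-(rateB P N C k nF a cK2 cK1 s δA δ₁ cK2 cK1 (n + n') * ((HiggsLattice.Site.tdist x x' : ℝ) / (P.L : ℝ) ^ k))) := by
  set M := n + n' with hM
  obtain ⟨hr0, -, hcv0, -, -⟩ := seqB_pos (P := P) (N := N) (C := C) (k := k) (nF := nF) (a := a) (cK2 := cK2) (cK1 := cK1) (s := s)
    (δA := δA) (δ₀ := δ₁) (cv₀ := cK2) (cd₀ := cK1) hL hδ₁ le_rfl hcK2 hcK1 hcK2 hcK1 hs hδA M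
  have hsM : 0 < (2 : ℝ) + (M : ℝ) - (P.d : ℝ) := by linarith
  have hε : 0 ≤ (P.mesh 0 ^ P.d)⁻¹ := inv_nonneg.mpr (pow_nonneg (P.mesh_pos 0).le _)
  have hpt : ∀ i' : Ix N, ‖op116 C Ω A B msq a k n n' (cb P N 0 (x', i')) x‖
      ≤ cvB P N C k nF a cK2 cK1 s δA δ₁ cK2 cK1 M / ((P.L : ℝ) ^ ((2 : ℝ) + (M : ℝ) - (P.d : ℝ)) - 1) * P.mesh k ^ ((2 : ℝ) + (M : ℝ) - (P.d : ℝ)) *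
          Real.exp (-(rateB P N C k nF a cK2 cK1 s δA δ₁ cK2 cK1 M * (P.mesh k)⁻¹ * (P.mesh 0 * (HiggsLattice.Site.tdist x x' : ℝ)))) := by
    intro i'
    have h := (state_op116_box_cb hL hk hkK hmsq hak hΩ hcK2 hcK1 hcolB hdcolB hcolAB hdcolAB hδ₁ hδ₁1 hs hA hδA hregA i₀ hF hexF henF
      hx' n n' i').2.1 x
    refine h.trans ?_
    unfold maj
    exact majorant_le_top hL hcv0 hsM hr0.le x x'
  calc (P.mesh 0 ^ P.d)⁻¹ * ∑ i' : Ix N, ‖op116 C Ω A B msq a k n n' (cb P N 0 (x', i')) x‖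
      ≤ (P.mesh 0 ^ P.d)⁻¹ * ∑ _i' : Ix N,
          cvB P N C k nF a cK2 cK1 s δA δ₁ cK2 cK1 M / ((P.L : ℝ) ^ ((2 : ℝ) + (M : ℝ) - (P.d : ℝ)) - 1) * P.mesh k ^ ((2 : ℝ) + (M : ℝ) - (P.d : ℝ)) *
            Real.exp (-(rateB P N C k nF a cK2 cK1 s δA δ₁ cK2 cK1 M * (P.mesh k)⁻¹ * (P.mesh 0 * (HiggsLattice.Site.tdist x x' : ℝ)))) :=
        mul_le_mul_of_nonneg_left (Finset.sum_le_sum fun i' _ => hpt i') hε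
    _ = _ := by
        rw [Finset.sum_const, Finset.card_univ, nsmul_eq_mul, mesh_rpow_split_two, rate_div_eq, valCB]
        ring

/-- **THE ROW DERIVATIVE OF THE KERNEL OF (1.16) ON `Ω` AT THE BONDS OF `Ω`, FOR ALL `n + n′ + 1 > d`, UP TO THE END SHEET**: at every bond
`⟨x, x+εe_μ⟩ ⊂ Ω`, `ε^{−d}Σ_{i′}‖(D^ε_B(1.16)^Ω_{n,n′}e_{(x′,i′)})(⟨x,μ⟩)‖ ≤ derCB(n+n′)·(L^kε)^{n+n′}·((L^kε)((L^kε)^d)^{−1})·e^{−δ_{n+n′}|x−x′|/L^k}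
+ ε^{−d}·N·Σ_iΣ_{u∈F_i}𝔪_k(c_{K1},1;δ_M)(x,u)·𝔪_k(cS_M,1+M;δ_M)(u,x′)` — the regular part in p40's binder shape `hDv` plus the LAST pending sheet, a
single layer on the faces read through the differentiated column of the last propagator (DISPLAYED, not estimated: `O(1)` iff `dist(x,∂Ω) ≳ L^k`, the
margin form is `B3Op116FaceSumsBorderline.face_sum_kernel_one_margin_le`; without margin it carries print's harmless `log` of p35 `DESIGN-FILE4.md` §14 (a)).
[cite: Balaban1983Higgs3, (1.16) p.414, (2.5) p.424, (2.10) p.426, p.433] [cite: Balaban1982Higgs1, (3.16) p.615] -/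
theorem kernel116_deriv_box_le (n n' : ℕ) (hd : (P.d : ℝ) < (n + n' : ℕ) + 1) (μ : Fin P.d) (x : HiggsLattice.Site P 0)
    (hxμ : Inside Ω ⟨x, μ⟩) :
    (P.mesh 0 ^ P.d)⁻¹ * ∑ i' : Ix N, ‖covDeriv C B (op116 C Ω A B msq a k n n' (cb P N 0 (x', i'))) ⟨x, μ⟩‖
      ≤ derCB P N C k nF a cK2 cK1 s δA δ₁ (n + n') * P.mesh k ^ (n + n') * (P.mesh k * (P.mesh k ^ P.d)⁻¹) *
          Real.exp (-(rateB P N C k nF a cK2 cK1 s δA δ₁ cK2 cK1 (n + n') * ((HiggsLattice.Site.tdist x x' : ℝ) / (P.L : ℝ) ^ k)))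
        + (P.mesh 0 ^ P.d)⁻¹ * (Fintype.card (Ix N) : ℝ) *
          ∑ i : Fin nF, ∑ u ∈ F i, maj P k cK1 1 (rateB P N C k nF a cK2 cK1 s δA δ₁ cK2 cK1 (n + n')) x u *
            maj P k (cSB P N C k nF a cK2 cK1 s δA δ₁ cK2 cK1 (n + n')) (1 + ((n + n' : ℕ) : ℝ))
              (rateB P N C k nF a cK2 cK1 s δA δ₁ cK2 cK1 (n + n')) u x' := by
  set M := n + n' with hM
  obtain ⟨hr0, -, -, hcd0, -⟩ := seqB_pos (P := P) (N := N) (C := C) (k := k) (nF := nF) (a := a) (cK2 := cK2) (cK1 := cK1) (s := s)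
    (δA := δA) (δ₀ := δ₁) (cv₀ := cK2) (cd₀ := cK1) hL hδ₁ le_rfl hcK2 hcK1 hcK2 hcK1 hs hδA M
  have hsM : 0 < (1 : ℝ) + (M : ℝ) - (P.d : ℝ) := by linarith
  have hε : 0 ≤ (P.mesh 0 ^ P.d)⁻¹ := inv_nonneg.mpr (pow_nonneg (P.mesh_pos 0).le _)
  have hsrc : (⟨x, μ⟩ : HiggsLattice.PBond P 0).src = x := rfl
  have eM : (2 : ℝ) + (M : ℝ) - 1 = 1 + (M : ℝ) := by ring
  set Sh : ℝ := ∑ i : Fin nF, ∑ u ∈ F i, maj P k cK1 1 (rateB P N C k nF a cK2 cK1 s δA δ₁ cK2 cK1 M) x u *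
    maj P k (cSB P N C k nF a cK2 cK1 s δA δ₁ cK2 cK1 M) (1 + (M : ℝ)) (rateB P N C k nF a cK2 cK1 s δA δ₁ cK2 cK1 M) u x' with hSh
  have hpt : ∀ i' : Ix N, ‖covDeriv C B (op116 C Ω A B msq a k n n' (cb P N 0 (x', i'))) ⟨x, μ⟩‖
      ≤ cdB P N C k nF a cK2 cK1 s δA δ₁ cK2 cK1 M / ((P.L : ℝ) ^ ((1 : ℝ) + (M : ℝ) - (P.d : ℝ)) - 1) * P.mesh k ^ ((1 : ℝ) + (M : ℝ) - (P.d : ℝ)) *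
          Real.exp (-(rateB P N C k nF a cK2 cK1 s δA δ₁ cK2 cK1 M * (P.mesh k)⁻¹ * (P.mesh 0 * (HiggsLattice.Site.tdist x x' : ℝ)))) + Sh := by
    intro i'
    obtain ⟨-, -, S, hS, hD⟩ := state_op116_box_cb hL hk hkK hmsq hak hΩ hcK2 hcK1 hcolB hdcolB hcolAB hdcolAB hδ₁ hδ₁1 hs hA hδA hregA i₀ hF
      hexF henF hx' n n' i'
    have h := hD ⟨x, μ⟩ hxμ
    rw [hsrc, eM] at h
    refine h.trans (add_le_add ?_ ?_)
    · unfold maj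
      exact majorant_le_top hL hcd0 hsM hr0.le x x'
    · rw [hSh]
      refine Finset.sum_le_sum fun i _ => Finset.sum_le_sum fun u _ => ?_
      have hSu := (hS u).2
      rw [eM] at hSu
      exact mul_le_mul_of_nonneg_left hSu (maj_nonneg hcK1 _ _)
  calc (P.mesh 0 ^ P.d)⁻¹ * ∑ i' : Ix N, ‖covDeriv C B (op116 C Ω A B msq a k n n' (cb P N 0 (x', i'))) ⟨x, μ⟩‖
      ≤ (P.mesh 0 ^ P.d)⁻¹ * ∑ _i' : Ix N,
          (cdB P N C k nF a cK2 cK1 s δA δ₁ cK2 cK1 M / ((P.L : ℝ) ^ ((1 : ℝ) + (M : ℝ) - (P.d : ℝ)) - 1) * P.mesh k ^ ((1 : ℝ) + (M : ℝ) - (P.d : ℝ)) *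
            Real.exp (-(rateB P N C k nF a cK2 cK1 s δA δ₁ cK2 cK1 M * (P.mesh k)⁻¹ * (P.mesh 0 * (HiggsLattice.Site.tdist x x' : ℝ)))) + Sh) :=
        mul_le_mul_of_nonneg_left (Finset.sum_le_sum fun i' _ => hpt i') hε
    _ = _ := by
        rw [Finset.sum_const, Finset.card_univ, nsmul_eq_mul, mesh_rpow_split_one, rate_div_eq, derCB, hSh, hM]
        push_cast
        ring

end Kernel

end Literature.MathematicalPhysics.QuantumFieldTheory.Balaban1983to89.B3Op116DKernelRegularBox

end
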